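import Literature.NumberTheory.LFunctions.AlternativeHypothesisFormFactor
import Literature.NumberTheory.LFunctions.AlternativeHypothesisTheorem1Proofs
import HarnessLib

/-!
# BGSTB 2025, Lemma 5 (Heath-Brown) (iii)–(iv) — proved (under RH and AH-Pairs)

Topic `Literature/NumberTheory/LFunctions` (namespace `Literature.NumberTheory.LFunctions`; helpers in
the sub-namespace `AH`). PROOF LAYER for `AlternativeHypothesisFormFactor.lean` (no named facts; one
plumbing definition `AH.fejerTest`, the test function of the proof), cell `rh-crit/ah` (C5, seat t5).
LABEL: **NOT RH-BEARING** — everything here is a CONDITIONAL `RiemannHypothesis → (AH-Pairs data) → …`;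
RH and AH-Pairs stay hypotheses and nothing here bears on the truth of either.

S. A. C. Baluyot, D. A. Goldston, A. I. Suriajaya, C. L. Turnage-Butterbaugh, *The Alternative
Hypothesis for zeros of the Riemann zeta-function*, arXiv:2508.10857 (2025), §5, **Lemma 5
(Heath-Brown) (iii)–(iv)**: "Assuming AH-Pairs, we have
(iii) `G_λ(α) = ∑_{k∈ℤ} e^{iπkα} (sin(λπk/2)/(λπk/2))² P_{k/2} + O(E_G(λ, α))`, and for `L ∈ ℤ`,
(iv) `G_λ(α + 2L) = G_λ(α) + O(E_G(λ, |α| + 2L))`", `E_G(λ, α) = 1/(λ²M) + (|α| + 1)M²R(T) + 1/log T`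
"where `M`, `T`, and `R(T)` are from AH-Pairs", `G_λ(α) = λ⁻² ∫_{−λ}^{λ} (λ − |β|) F(α + β) dβ`.

## What is proved, and how it relates to the named claim `bgstb2025_lemma5_ah`

`bgstb2025_lemma5_ah_of_RH : RiemannHypothesis → ∀ M > 0, ∀ R, AH.IsPairsRate M R → ∀ δ ∈ (0, 1/2],
∃ C, ∀ᶠ T, ∀ λ ∈ (0, 1/2], ∀ α, ‖G_λ(α) − ∑_k e^{iπkα} sinc²(λπk/2) P_{k/2}(T)‖ ≤ C E_G(λ, α) ∧
∀ L : ℤ, |G_λ(α + 2L) − G_λ(α)| ≤ C E_G(λ, |α| + 2|L|)` (`AH.heathBrownG_approx`,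
`AH.heathBrownG_add_two_mul_sub_le`). This is the statement §5 of the source PROVES; it differs from
the typed-as-printed claim `bgstb2025_lemma5_ah` (`AlternativeHypothesisFormFactor.lean`) in two
places, both documented rather than papered over: (1) the printed proof removes the pairs outside
`𝒫(T, M)` and bounds `|𝒫(T, M)| ≪ M T log T` by (zeropairbound), which the source takes "from
[GM87]" — Goldston–Montgomery's pair count, a theorem UNDER RH (here: the tree's PROVED pair-window
count `RudnickSarnak.exists_pairCount_window_le hRH`); so RH is a hypothesis of what is proved,
although the printed statement of (iii) names only AH-Pairs; (2) "(iv) follows immediately from (iii)"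
gives the error `E_G(λ, α) + E_G(λ, α + 2L) ≤ 2E_G(λ, |α| + 2|L|)`; with the printed signed `|α| + 2L`
and `L < 0` (e.g. `α = 2|L|`) the claimed bound does not follow. The named claim is therefore left
undischarged (it is not known to be false — it speaks about the actual zeros — but it is not what the
source proves); this file proves the corrected form.

## The printed proof (§5) and how it is followed

* (G_λ2): `G_λ(α) = ((T/2π) log T)⁻¹ ∑_{0<γ,γ'≤T} T^{iα(γ−γ')} K_λ((γ−γ') log T) w(γ−γ')` — here
  `G_λ(α)(T/2π) log T = ∑ ĝ(y) w` for the test function `g = g_{λ,−α} = λ⁻² k_λ(· + α)`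
  (`AH.fejerTest`), `ĝ(y) = e(αy) sinc²(πλy)` (`AH.fourier_fejerTest`: translation × Fejér's
  integral `∫_{−λ}^{λ}(λ − |β|)e^{icβ} dβ = λ² sinc²(cλ/2)`, `AH.integral_tri_cexp`), via the tree's
  (MT-Pairs) first display `AH.sum_fourier_pairSpacing_eq_integral` and `G_λ(−α) = G_λ(α)`
  (`AH.heathBrownG_mul_eq_sum`).
* "`|K_λ(y + h) − K_λ(y)| ≤ max_{|β|≤λ}|e^{ihβ} − 1| λ⁻²∫(λ − |β|)dβ ≪ min{1, λh}`" and the phase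
  `e^{iα(kπ + O(…))} = e^{iπkα}(1 + O(|α|(|k|+1)R))`: both at once as the `L¹`-Lipschitz bound
  `‖ĝ(x) − ĝ(y)‖ ≤ 2π(|α| + 1)|x − y|` (`AH.norm_fourier_sub_fourier_le_of_support_le`,
  `AH.norm_fourier_fejerTest_sub_le`; uniform in `λ` because `‖g‖₁ = 1`).
* Pairs outside `𝒫(T, M)`: `|ĝ(y)| ≤ min(1, 4λ⁻²(1 + |y|)⁻²)`, the low pairs are `O(T)` (unit
  windows, `AH.card_pairs_offWindow_le`), `|y| ≲ log T` is `O(T log T/λ²)` by the pair-window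
  count and shells (`RudnickSarnak.card_filter_abs_le_le`, `sum_filter_mid_le`), `|γ − γ'| ≳ 1`
  is `O(T log T/λ²)` by unit windows row by row (`AH.sum_sdiff_pairs_le`); all `≤ K T log T/λ²`,
  i.e. `O(1/(λ²M))` after the normalisation with an `M`-dependent constant, as `E_G` allows.
* On `𝒫(T, M) = ⊔_k B_{k/2}` (AH-Pairs localisation with the rate: `|y − k/2| ≤ C(4M+2)R(T)`,
  `AH.pairs_eq_biUnion_bin`): `∑_{𝒫} ĝ(y)w − ∑_k ĝ(k/2)|B_{k/2}| ≪ ((|α|+1) M R(T) + M²/log²T)|𝒫|`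
  (`AH.norm_sum_pairs_sub_sum_bins_le`, `1 − w ≤ π²M²/log²T`), `|𝒫(T,M)| ≪_M T log T`
  (`AH.card_pairs_le_window`); `ĝ(k/2) = e^{iπkα} sinc²(λπk/2)`, the `k`-series is a finite sum
  (`AH.tsum_mul_binDensity_eq_sum`).
* (iv): `e^{iπk(α+2L)} = e^{iπkα}` and the triangle inequality (`AH.heathBrownG_add_two_mul_sub_le`).

## References

* [BaluyotGoldstonSuriajayaTurnageButterbaugh2025] arXiv:2508.10857, §5: (G_λ), (k_λ), (K-Fejer),
  (G_λ2), (E_G), Lemma 5, proof of (iii)–(iv) (held text `paper:arxiv-2508.10857`, p0012–p0013);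
  §3 (zeropairbound), (P-bound) (p0009).
* [GoldstonMontgomery1987] D. A. Goldston, H. L. Montgomery, *Pair correlation of zeros and primes in
  short intervals*, Progr. Math. 70 (1987) — the RH pair count (zeropairbound).
* [Montgomery1973] H. L. Montgomery, Proc. Sympos. Pure Math. 24 (1973) (the pair-window count used
  here is the tree's corollary of Montgomery's theorem).
-/

noncomputable section

open scoped Real Topology FourierTransform
open Filter Set MeasureTheory Asymptotics

namespace Literature.NumberTheory.LFunctions

namespace AH

/-! ## L1. The Fejér pair `k_λ`, `K_λ` -/

/-- `∫_{−λ}^{λ} (λ − |β|) dβ = λ²`. [folklore] -/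
private theorem integral_tri (lam : ℝ) (hlam : 0 < lam) :
    ∫ β in (-lam)..lam, (lam - |β|) = lam ^ 2 := by
  have hcont : Continuous fun β : ℝ ↦ lam - |β| := by fun_prop
  rw [← intervalIntegral.integral_add_adjacent_intervals (b := 0) (hcont.intervalIntegrable _ _)
    (hcont.intervalIntegrable _ _)]
  have h1 : ∫ β in (-lam)..0, (lam - |β|) = ∫ β in (-lam)..0, (lam + β) := by
    refine intervalIntegral.integral_congr fun β hβ ↦ ?_
    rw [Set.uIcc_of_le (by linarith)] at hβ
    simp only [abs_of_nonpos hβ.2]; ring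
  have h2 : ∫ β in (0 : ℝ)..lam, (lam - |β|) = ∫ β in (0 : ℝ)..lam, (lam - β) := by
    refine intervalIntegral.integral_congr fun β hβ ↦ ?_
    rw [Set.uIcc_of_le hlam.le] at hβ
    simp only [abs_of_nonneg hβ.1]
  have hd1 : ∀ β : ℝ, HasDerivAt (fun b : ℝ ↦ lam * b + b ^ 2 / 2) (lam + β) β := by
    intro β
    have h := ((hasDerivAt_id β).const_mul lam).add ((hasDerivAt_pow 2 β).div_const 2)
    refine h.congr_deriv ?_
    simp
  have hd2 : ∀ β : ℝ, HasDerivAt (fun b : ℝ ↦ lam * b - b ^ 2 / 2) (lam - β) β := by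
    intro β
    have h := ((hasDerivAt_id β).const_mul lam).sub ((hasDerivAt_pow 2 β).div_const 2)
    refine h.congr_deriv ?_
    simp
  rw [h1, h2, intervalIntegral.integral_eq_sub_of_hasDerivAt (fun β _ ↦ hd1 β)
      ((by fun_prop : Continuous fun β : ℝ ↦ lam + β).intervalIntegrable _ _),
    intervalIntegral.integral_eq_sub_of_hasDerivAt (fun β _ ↦ hd2 β)
      ((by fun_prop : Continuous fun β : ℝ ↦ lam - β).intervalIntegrable _ _)]
  ring

/-- The exponential `E_c(β) = e^{icβ}` has derivative `ic E_c(β)`. [folklore] -/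
private theorem hasDerivAt_cexp_mul_I (c β : ℝ) :
    HasDerivAt (fun b : ℝ ↦ Complex.exp (↑(c * b) * Complex.I))
      (Complex.exp (↑(c * β) * Complex.I) * (c * Complex.I)) β := by
  have h1 : HasDerivAt (fun b : ℝ ↦ (↑(c * b) * Complex.I : ℂ)) (c * Complex.I) β := by
    have h := ((hasDerivAt_id β).const_mul c).ofReal_comp.mul_const Complex.I
    simpa using h
  exact h1.cexp

/-- **Fejér's integral** `∫_{−λ}^{λ} (λ − |β|) e^{icβ} dβ = λ² (sin(cλ/2)/(cλ/2))²`
(BGSTB 2025, §5, (K-Fejer): `K_λ(y) = (sin(λy/2)/(λy/2))² = λ⁻² ∫ k_λ(β) e^{iyβ} dβ`).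
[cite: BaluyotGoldstonSuriajayaTurnageButterbaugh2025, §5 (K-Fejer)] -/
theorem integral_tri_cexp (lam : ℝ) (hlam : 0 < lam) (c : ℝ) :
    ∫ β in (-lam)..lam, ((lam - |β| : ℝ) : ℂ) * Complex.exp (↑(c * β) * Complex.I) =
      ((lam ^ 2 * Real.sinc (c * lam / 2) ^ 2 : ℝ) : ℂ) := by
  rcases eq_or_ne c 0 with rfl | hc
  · simp only [zero_mul, Complex.ofReal_zero, Complex.exp_zero, mul_one, zero_div,
      Real.sinc_zero, one_pow]
    rw [intervalIntegral.integral_ofReal, integral_tri lam hlam]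
  have hcC : (c : ℂ) ≠ 0 := Complex.ofReal_ne_zero.mpr hc
  have hcont : Continuous fun β : ℝ ↦ ((lam - |β| : ℝ) : ℂ) * Complex.exp (↑(c * β) * Complex.I) := by
    fun_prop
  rw [← intervalIntegral.integral_add_adjacent_intervals (b := 0) (hcont.intervalIntegrable _ _)
    (hcont.intervalIntegrable _ _)]
  set E : ℝ → ℂ := fun b ↦ Complex.exp (↑(c * b) * Complex.I) with hE
  -- on `[0, λ]`: primitive `P(β) = (i(β − λ)/c − 1/c²) E(β)`
  have hP : ∀ β : ℝ, HasDerivAt (fun b : ℝ ↦ (Complex.I * ((b : ℂ) - lam) / c - 1 / (c : ℂ) ^ 2) * E b)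
      (((lam - β : ℝ) : ℂ) * E β) β := by
    intro β
    have hA : HasDerivAt (fun b : ℝ ↦ (Complex.I * ((b : ℂ) - lam) / c - 1 / (c : ℂ) ^ 2))
        (Complex.I / c) β := by
      have h := (((hasDerivAt_id β).ofReal_comp.sub_const (lam : ℂ)).const_mul Complex.I).div_const (c : ℂ)
      simpa using h.sub_const (1 / (c : ℂ) ^ 2)
    have h := hA.mul (hasDerivAt_cexp_mul_I c β)
    refine h.congr_deriv ?_
    rw [hE]; push_cast
    field_simp
    ring_nf
    rw [Complex.I_sq]; ring
  -- on `[−λ, 0]`: primitive `Q(β) = (−iλ/c + 1/c² − iβ/c) E(β)`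
  have hQ : ∀ β : ℝ, HasDerivAt (fun b : ℝ ↦ (-Complex.I * lam / c + 1 / (c : ℂ) ^ 2 - Complex.I * (b : ℂ) / c) * E b)
      (((lam + β : ℝ) : ℂ) * E β) β := by
    intro β
    have hA : HasDerivAt (fun b : ℝ ↦ (-Complex.I * lam / c + 1 / (c : ℂ) ^ 2 - Complex.I * (b : ℂ) / c))
        (-(Complex.I / c)) β := by
      have h := ((hasDerivAt_id β).ofReal_comp.const_mul Complex.I).div_const (c : ℂ)
      have h2 := h.const_sub (-Complex.I * lam / c + 1 / (c : ℂ) ^ 2)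
      simpa using h2
    have h := hA.mul (hasDerivAt_cexp_mul_I c β)
    refine h.congr_deriv ?_
    rw [hE]; push_cast
    field_simp
    ring_nf
    rw [Complex.I_sq]; ring
  have h1 : ∫ β in (-lam)..0, ((lam - |β| : ℝ) : ℂ) * E β = ∫ β in (-lam)..0, ((lam + β : ℝ) : ℂ) * E β := by
    refine intervalIntegral.integral_congr fun β hβ ↦ ?_
    rw [Set.uIcc_of_le (by linarith)] at hβ
    simp only [abs_of_nonpos hβ.2, sub_neg_eq_add]
  have h2 : ∫ β in (0 : ℝ)..lam, ((lam - |β| : ℝ) : ℂ) * E β = ∫ β in (0 : ℝ)..lam, ((lam - β : ℝ) : ℂ) * E β := by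
    refine intervalIntegral.integral_congr fun β hβ ↦ ?_
    rw [Set.uIcc_of_le hlam.le] at hβ
    simp only [abs_of_nonneg hβ.1]
  have hi1 : IntervalIntegrable (fun β : ℝ ↦ ((lam + β : ℝ) : ℂ) * E β) volume (-lam) 0 :=
    (by rw [hE]; fun_prop : Continuous fun β : ℝ ↦ ((lam + β : ℝ) : ℂ) * E β).intervalIntegrable _ _
  have hi2 : IntervalIntegrable (fun β : ℝ ↦ ((lam - β : ℝ) : ℂ) * E β) volume 0 lam :=
    (by rw [hE]; fun_prop : Continuous fun β : ℝ ↦ ((lam - β : ℝ) : ℂ) * E β).intervalIntegrable _ _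
  rw [h1, h2, intervalIntegral.integral_eq_sub_of_hasDerivAt (fun β _ ↦ hQ β) hi1,
    intervalIntegral.integral_eq_sub_of_hasDerivAt (fun β _ ↦ hP β) hi2]
  -- evaluate: total `= (2 − E(λ) − E(−λ))/c² = (2 − 2cos(cλ))/c² = λ² sinc²(cλ/2)`
  have hEl : E lam = Complex.exp (↑(c * lam) * Complex.I) := rfl
  have hEnl : E (-lam) = Complex.exp (-(↑(c * lam) * Complex.I)) := by
    rw [hE]; dsimp only; congr 1; push_cast; ring
  have hE0 : E 0 = 1 := by rw [hE]; simp
  rw [hEl, hEnl, hE0]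
  have hcos : Complex.exp ((c : ℂ) * (lam : ℂ) * Complex.I) + Complex.exp (-((c : ℂ) * (lam : ℂ) * Complex.I)) =
      2 * Complex.cos ((c : ℂ) * (lam : ℂ)) := by
    rw [Complex.cos]; ring
  have hsinc : lam ^ 2 * Real.sinc (c * lam / 2) ^ 2 = (2 - 2 * Real.cos (c * lam)) / c ^ 2 := by
    have hx : c * lam / 2 ≠ 0 := by positivity
    rw [Real.sinc_of_ne_zero hx, div_pow]
    have h3 : Real.cos (c * lam) = 1 - 2 * Real.sin (c * lam / 2) ^ 2 := by
      have h := Real.cos_two_mul (c * lam / 2)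
      rw [show 2 * (c * lam / 2) = c * lam by ring] at h
      nlinarith [Real.sin_sq_add_cos_sq (c * lam / 2)]
    rw [h3]
    field_simp
    ring
  rw [hsinc]
  push_cast
  linear_combination (-(1 : ℂ) / (c : ℂ) ^ 2) * hcos

/-! ## L2. The test function `g_{λ,α}(v) = λ⁻² k_λ(v − α)` and its Fourier transform -/

/-- **The shifted, normalised triangle** `g_{λ,α}(v) := λ⁻² k_λ(v − α) = λ⁻² max(λ − |v − α|, 0)`
(BGSTB 2025, §5, (k_λ): "`k_λ(β) := max(λ − |β|, 0)`"), so that `∫ F(a, T) g_{λ,α}(a) da = G_λ(α)`.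
[cite: BaluyotGoldstonSuriajayaTurnageButterbaugh2025, §5 (k_λ)] -/
def fejerTest (lam α v : ℝ) : ℝ := (lam ^ 2)⁻¹ * max (lam - |v - α|) 0

/-- `g_{λ,α} ≥ 0`. [cite: BaluyotGoldstonSuriajayaTurnageButterbaugh2025, §5 (k_λ)] -/
theorem fejerTest_nonneg (lam α v : ℝ) : 0 ≤ fejerTest lam α v := by
  unfold fejerTest; positivity

/-- `g_{λ,α} ≤ 1/λ`. [cite: BaluyotGoldstonSuriajayaTurnageButterbaugh2025, §5 (k_λ)] -/
theorem fejerTest_le {lam : ℝ} (hlam : 0 < lam) (α v : ℝ) : fejerTest lam α v ≤ lam⁻¹ := by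
  unfold fejerTest
  have h : max (lam - |v - α|) 0 ≤ lam := max_le (by linarith [abs_nonneg (v - α)]) hlam.le
  calc (lam ^ 2)⁻¹ * max (lam - |v - α|) 0 ≤ (lam ^ 2)⁻¹ * lam := by gcongr
    _ = lam⁻¹ := by field_simp

/-- `g_{λ,α}(v) = 0` for `|v − α| ≥ λ`. [cite: BaluyotGoldstonSuriajayaTurnageButterbaugh2025, §5 (k_λ)] -/
theorem fejerTest_eq_zero {lam α v : ℝ} (h : lam ≤ |v - α|) : fejerTest lam α v = 0 := by
  unfold fejerTest
  rw [max_eq_right (by linarith), mul_zero]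

/-- `g_{λ,α}(v) = λ⁻²(λ − |v − α|)` for `|v − α| ≤ λ`. [cite: BaluyotGoldstonSuriajayaTurnageButterbaugh2025, §5 (k_λ)] -/
theorem fejerTest_eq_of_abs_le {lam α v : ℝ} (h : |v - α| ≤ lam) :
    fejerTest lam α v = (lam ^ 2)⁻¹ * (lam - |v - α|) := by
  unfold fejerTest
  rw [max_eq_left (by linarith)]

/-- `g_{λ,α}` is continuous. [cite: BaluyotGoldstonSuriajayaTurnageButterbaugh2025, §5 (k_λ)] -/
theorem continuous_fejerTest (lam α : ℝ) : Continuous (fejerTest lam α) := by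
  unfold fejerTest; fun_prop

/-- `g_{λ,α}` has compact support (`⊆ [α − λ, α + λ]`). [cite: BaluyotGoldstonSuriajayaTurnageButterbaugh2025, §5 (k_λ)] -/
theorem hasCompactSupport_fejerTest (lam α : ℝ) : HasCompactSupport (fejerTest lam α) := by
  refine HasCompactSupport.of_support_subset_isCompact (K := Icc (α - lam) (α + lam)) isCompact_Icc ?_
  intro v hv
  rw [Function.mem_support] at hv
  by_contra hcon
  apply hv
  apply fejerTest_eq_zero
  rw [Set.mem_Icc, not_and_or, not_le, not_le] at hcon
  rcases hcon with h | h
  · exact le_trans (by linarith) (neg_le_abs (v - α))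
  · exact le_trans (by linarith) (le_abs_self (v - α))

/-- `g_{λ,α} ∈ L¹`. [cite: BaluyotGoldstonSuriajayaTurnageButterbaugh2025, §5 (k_λ)] -/
theorem integrable_fejerTest (lam α : ℝ) : Integrable (fejerTest lam α) :=
  (continuous_fejerTest lam α).integrable_of_hasCompactSupport (hasCompactSupport_fejerTest lam α)

/-- Reduction of `∫_ℝ φ(a) g_{λ,α}(a) da` to `λ⁻² ∫_{−λ}^{λ} (λ − |β|) φ(α + β) dβ`. [folklore] -/
private theorem integral_mul_fejerTest {lam : ℝ} (hlam : 0 < lam) (α : ℝ) (φ : ℝ → ℂ) :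
    ∫ a, φ a * (fejerTest lam α a : ℂ) =
      (lam ^ 2 : ℂ)⁻¹ * ∫ β in (-lam)..lam, ((lam - |β| : ℝ) : ℂ) * φ (α + β) := by
  have hzero : ∀ a ∉ Icc (α - lam) (α + lam), φ a * (fejerTest lam α a : ℂ) = 0 := by
    intro a ha
    rw [Set.mem_Icc, not_and_or, not_le, not_le] at ha
    have : lam ≤ |a - α| := by
      rcases ha with h | h
      · exact le_trans (by linarith) (neg_le_abs (a - α))
      · exact le_trans (by linarith) (le_abs_self (a - α))
    rw [fejerTest_eq_zero this, Complex.ofReal_zero, mul_zero]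
  rw [← setIntegral_eq_integral_of_forall_compl_eq_zero hzero, integral_Icc_eq_integral_Ioc,
    ← intervalIntegral.integral_of_le (by linarith),
    show α - lam = -lam + α by ring, show α + lam = lam + α by ring,
    ← intervalIntegral.integral_comp_add_right (fun a ↦ φ a * (fejerTest lam α a : ℂ)) α,
    ← intervalIntegral.integral_const_mul]
  refine intervalIntegral.integral_congr fun β hβ ↦ ?_
  rw [Set.uIcc_of_le (by linarith)] at hβ
  have hβ' : |β + α - α| ≤ lam := by rw [add_sub_cancel_right]; exact abs_le.mpr ⟨hβ.1, hβ.2⟩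
  rw [fejerTest_eq_of_abs_le hβ', add_sub_cancel_right, add_comm β α]
  push_cast
  ring

/-- `∫ g_{λ,α} = 1`. [cite: BaluyotGoldstonSuriajayaTurnageButterbaugh2025, §5 (k_λ)] -/
theorem integral_fejerTest {lam : ℝ} (hlam : 0 < lam) (α : ℝ) : ∫ v, fejerTest lam α v = 1 := by
  have h := integral_mul_fejerTest hlam α (fun _ ↦ (1 : ℂ))
  simp only [one_mul, mul_one] at h
  rw [integral_complex_ofReal, intervalIntegral.integral_ofReal, integral_tri lam hlam] at h
  have hlamC : (lam : ℂ) ≠ 0 := Complex.ofReal_ne_zero.mpr hlam.ne'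
  have h' : ((∫ v, fejerTest lam α v : ℝ) : ℂ) = ((1 : ℝ) : ℂ) := by
    rw [h]; push_cast; field_simp
  exact_mod_cast h'

/-- **`ĝ_{λ,α}(y) = e(−αy) (sin(πλy)/(πλy))²`** (translation × Fejér: BGSTB 2025, §5, (K-Fejer) with
`y ↦ 2πy`). [cite: BaluyotGoldstonSuriajayaTurnageButterbaugh2025, §5 (K-Fejer)] -/
theorem fourier_fejerTest {lam : ℝ} (hlam : 0 < lam) (α y : ℝ) :
    𝓕 (fun v : ℝ ↦ (fejerTest lam α v : ℂ)) y =
      Complex.exp (↑(-2 * π * α * y) * Complex.I) * ((Real.sinc (π * lam * y) ^ 2 : ℝ) : ℂ) := by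
  rw [Real.fourier_real_eq_integral_exp_smul]
  simp only [smul_eq_mul]
  rw [integral_mul_fejerTest hlam α]
  have e1 : (fun β : ℝ ↦ ((lam - |β| : ℝ) : ℂ) * Complex.exp (↑(-2 * π * (α + β) * y) * Complex.I)) =
      fun β ↦ Complex.exp (↑(-2 * π * α * y) * Complex.I) *
        (((lam - |β| : ℝ) : ℂ) * Complex.exp (↑((-2 * π * y) * β) * Complex.I)) := by
    funext β
    have : Complex.exp (↑(-2 * π * (α + β) * y) * Complex.I) =
        Complex.exp (↑(-2 * π * α * y) * Complex.I) * Complex.exp (↑((-2 * π * y) * β) * Complex.I) := by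
      rw [← Complex.exp_add]; congr 1; push_cast; ring
    rw [this]; ring
  rw [e1, intervalIntegral.integral_const_mul, integral_tri_cexp lam hlam]
  have e2 : -2 * π * y * lam / 2 = -(π * lam * y) := by ring
  rw [e2, Real.sinc_neg]
  have hlamC : (lam : ℂ) ≠ 0 := Complex.ofReal_ne_zero.mpr hlam.ne'
  push_cast
  field_simp

/-- `|ĝ_{λ,α}(y)| ≤ 1`. [cite: BaluyotGoldstonSuriajayaTurnageButterbaugh2025, §5 (K-Fejer)] -/
theorem norm_fourier_fejerTest_le {lam : ℝ} (hlam : 0 < lam) (α y : ℝ) :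
    ‖𝓕 (fun v : ℝ ↦ (fejerTest lam α v : ℂ)) y‖ ≤ 1 := by
  rw [fourier_fejerTest hlam, norm_mul, Complex.norm_exp_ofReal_mul_I, one_mul, Complex.norm_real,
    Real.norm_eq_abs, abs_of_nonneg (sq_nonneg _)]
  have h := Real.abs_sinc_le_one (π * lam * y)
  have h2 : Real.sinc (π * lam * y) ^ 2 = |Real.sinc (π * lam * y)| ^ 2 := (sq_abs _).symm
  rw [h2]
  exact pow_le_one₀ (abs_nonneg _) h

/-- **`L¹`-Lipschitz bound for Fourier transforms of compactly supported functions**: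
if `g = 0` off `[−S, S]` then `‖ĝ(x) − ĝ(y)‖ ≤ 2πS |x − y| ‖g‖₁` (`|e(−vx) − e(−vy)| ≤ 2π|v||x − y|`;
BGSTB 2025, §5: "`|K_λ(y + h) − K_λ(y)| ≤ max_{|β|≤λ} |e^{ihβ} − 1| λ⁻² ∫ (λ − |β|) dβ`").
[cite: BaluyotGoldstonSuriajayaTurnageButterbaugh2025, §5 (proof of Lemma 5)] -/
theorem norm_fourier_sub_fourier_le_of_support_le {g : ℝ → ℂ} (hg : Integrable g) {S : ℝ}
    (hsupp : ∀ v, S < |v| → g v = 0) (x y : ℝ) :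
    ‖𝓕 g x - 𝓕 g y‖ ≤ 2 * π * S * |x - y| * ∫ v, ‖g v‖ := by
  have hint : ∀ z : ℝ, Integrable fun v : ℝ ↦ Complex.exp (↑(-2 * π * v * z) * Complex.I) * g v := by
    intro z
    refine hg.bdd_mul (c := 1) ?_ (Eventually.of_forall fun v ↦ ?_)
    · exact (by fun_prop : Continuous fun v : ℝ ↦
        Complex.exp (↑(-2 * π * v * z) * Complex.I)).aestronglyMeasurable
    · rw [Complex.norm_exp_ofReal_mul_I]
  have e0 : 𝓕 g x - 𝓕 g y =
      ∫ v, (Complex.exp (↑(-2 * π * v * x) * Complex.I) * g v -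
        Complex.exp (↑(-2 * π * v * y) * Complex.I) * g v) := by
    rw [Real.fourier_real_eq_integral_exp_smul, Real.fourier_real_eq_integral_exp_smul]
    simp_rw [smul_eq_mul]
    rw [integral_sub (hint x) (hint y)]
  have hbound : ∀ v : ℝ, ‖Complex.exp (↑(-2 * π * v * x) * Complex.I) * g v -
      Complex.exp (↑(-2 * π * v * y) * Complex.I) * g v‖ ≤ 2 * π * S * |x - y| * ‖g v‖ := by
    intro v
    by_cases hv : |v| ≤ S
    · rw [← sub_mul, norm_mul]
      have hphase : ‖Complex.exp (↑(-2 * π * v * x) * Complex.I) -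
          Complex.exp (↑(-2 * π * v * y) * Complex.I)‖ ≤ 2 * π * |x - y| * |v| := by
        have e : Complex.exp (↑(-2 * π * v * x) * Complex.I) -
            Complex.exp (↑(-2 * π * v * y) * Complex.I) =
            Complex.exp (↑(-2 * π * v * y) * Complex.I) *
              (Complex.exp (Complex.I * ↑(-2 * π * v * (x - y))) - 1) := by
          rw [mul_sub, mul_one, ← Complex.exp_add]
          congr 2
          push_cast
          ring
        rw [e, norm_mul, Complex.norm_exp_ofReal_mul_I, one_mul]
        refine (Real.norm_exp_I_mul_ofReal_sub_one_le).trans (le_of_eq ?_)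
        rw [Real.norm_eq_abs, abs_mul, abs_mul, abs_mul, abs_neg, abs_two, abs_of_pos Real.pi_pos]
        ring
      calc ‖Complex.exp (↑(-2 * π * v * x) * Complex.I) -
            Complex.exp (↑(-2 * π * v * y) * Complex.I)‖ * ‖g v‖
          ≤ 2 * π * |x - y| * |v| * ‖g v‖ := mul_le_mul_of_nonneg_right hphase (norm_nonneg _)
        _ ≤ 2 * π * |x - y| * S * ‖g v‖ := by gcongr
        _ = 2 * π * S * |x - y| * ‖g v‖ := by ring
    · push Not at hv
      simp [hsupp v hv]
  rw [e0]
  calc ‖∫ v, (Complex.exp (↑(-2 * π * v * x) * Complex.I) * g v -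
        Complex.exp (↑(-2 * π * v * y) * Complex.I) * g v)‖
      ≤ ∫ v, 2 * π * S * |x - y| * ‖g v‖ :=
        norm_integral_le_of_norm_le (hg.norm.const_mul _) (Eventually.of_forall hbound)
    _ = 2 * π * S * |x - y| * ∫ v, ‖g v‖ := integral_const_mul _ _

/-- **Lipschitz bound for `ĝ_{λ,α}`, uniform in `λ`:** `‖ĝ_{λ,α}(x) − ĝ_{λ,α}(y)‖ ≤ 2π(|α| + 1)|x − y|`
(for `0 < λ ≤ 1`; BGSTB 2025, §5: "`e^{iα(kπ + O(…))} K_λ(kπ + O(…)) = e^{iπkα} K_λ(kπ) +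
O((|α| + λ)(|k| + 1) R(T))`"). [cite: BaluyotGoldstonSuriajayaTurnageButterbaugh2025, §5 (proof of Lemma 5)] -/
theorem norm_fourier_fejerTest_sub_le {lam : ℝ} (hlam : 0 < lam) (hlam1 : lam ≤ 1) (α x y : ℝ) :
    ‖𝓕 (fun v : ℝ ↦ (fejerTest lam α v : ℂ)) x - 𝓕 (fun v : ℝ ↦ (fejerTest lam α v : ℂ)) y‖ ≤
      2 * π * (|α| + 1) * |x - y| := by
  have hg : Integrable fun v : ℝ ↦ (fejerTest lam α v : ℂ) := (integrable_fejerTest lam α).ofReal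
  have hsupp : ∀ v, |α| + 1 < |v| → (fejerTest lam α v : ℂ) = 0 := by
    intro v hv
    rw [fejerTest_eq_zero, Complex.ofReal_zero]
    have := abs_sub_abs_le_abs_sub v α
    linarith
  have h := norm_fourier_sub_fourier_le_of_support_le hg hsupp x y
  have hn : ∫ v, ‖(fejerTest lam α v : ℂ)‖ = 1 := by
    have : (fun v ↦ ‖(fejerTest lam α v : ℂ)‖) = fejerTest lam α := by
      funext v; rw [Complex.norm_real, Real.norm_eq_abs, abs_of_nonneg (fejerTest_nonneg _ _ _)]
    rw [this, integral_fejerTest hlam]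
  rw [hn, mul_one] at h
  exact h

/-! ## L3. `G_λ(α)` as a pair sum -/

/-- **(G_λ2)**: `G_λ(α) (T/2π) log T = ∑_{0<γ,γ'≤T} ĝ_{λ,−α}(y) w(γ − γ')` with
`ĝ_{λ,−α}(y) = e(αy)(sin πλy/(πλy))²`, `y = (γ−γ') log T/2π` — i.e. the printed
`G_λ(α) = ((T/2π) log T)⁻¹ ∑ T^{iα(γ−γ')} K_λ((γ−γ') log T) w(γ−γ')`, via (MT-Pairs)'s first display
and `G_λ(−α) = G_λ(α)`. [cite: BaluyotGoldstonSuriajayaTurnageButterbaugh2025, §5 (G_λ2)] -/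
theorem heathBrownG_mul_eq_sum {lam : ℝ} (hlam : 0 < lam) {T : ℝ} (hT : 1 < T) (α : ℝ) :
    ((heathBrownG lam α T * (T / (2 * π) * Real.log T) : ℝ) : ℂ) =
      ∑ p ∈ zeroIndexSet T ×ˢ zeroIndexSet T,
        𝓕 (fun v : ℝ ↦ (fejerTest lam (-α) v : ℂ)) (pairSpacing T p) *
          (montgomeryWeight (zetaOrdinate p.1 - zetaOrdinate p.2) : ℂ) := by
  rw [sum_fourier_pairSpacing_eq_integral (fejerTest lam (-α)) (integrable_fejerTest lam (-α)) hT,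
    ← heathBrownG_neg lam α T]
  congr 1
  rw [mul_comm]
  congr 1
  unfold heathBrownG
  have h := integral_mul_fejerTest hlam (-α) (fun a ↦ (montgomeryFormFactor a T : ℂ))
  have h2 : ((∫ a, montgomeryFormFactor a T * fejerTest lam (-α) a : ℝ) : ℂ) =
      ∫ a, (montgomeryFormFactor a T : ℂ) * (fejerTest lam (-α) a : ℂ) := by
    rw [← integral_complex_ofReal]; push_cast; rfl
  apply Complex.ofReal_injective
  rw [h2, h]
  push_cast
  rw [← intervalIntegral.integral_ofReal]
  congr 1
  · field_simp
  · push_cast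
    refine intervalIntegral.integral_congr fun β _ ↦ ?_
    ring

/-! ## L4. Counting and localisation on `𝒫(T, M)` -/

/-- **`|𝒫(T, M)| ≪ M T log T`** (BGSTB's (P-bound), from (zeropairbound) = Goldston–Montgomery under
RH; here via the tree's pair-window count): `|𝒫(T,M)| ≤ 2 C_w T log T (⌊M/y₀⌋ + 1)`.
[cite: BaluyotGoldstonSuriajayaTurnageButterbaugh2025, §3 (P-bound)] -/
theorem card_pairs_le_window {T M y₀ C_w : ℝ} (hM : 0 ≤ M) (hy₀ : 0 < y₀)
    (hwin : ∀ s : ℝ, |s| + y₀ ≤ Real.log T / π →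
      (((zeroIndexSet T ×ˢ zeroIndexSet T).filter fun p ↦
          |Real.log T / (2 * π) * (zetaOrdinate p.1 - zetaOrdinate p.2) - s| ≤ y₀).card : ℝ) ≤
        C_w * (T * Real.log T))
    (hL : (M / y₀ + 5 / 2) * y₀ ≤ Real.log T / π) :
    ((pairs T M).card : ℝ) ≤ 2 * (C_w * (T * Real.log T)) * (⌊M / y₀⌋₊ + 1) := by
  have hsub : pairs T M ⊆ ((zeroIndexSet T ×ˢ zeroIndexSet T).filter fun p ↦
      |Real.log T / (2 * π) * (zetaOrdinate p.1 - zetaOrdinate p.2)| ≤ M) := by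
    intro p hp
    rw [mem_pairs] at hp
    rw [Finset.mem_filter, ← pairSpacing_eq]
    exact ⟨hp.1, hp.2.2.2⟩
  have hwin' : ∀ s : ℝ, |s| + y₀ ≤ Real.log T / π →
      (((zeroIndexSet T ×ˢ zeroIndexSet T).filter fun p ↦
          |Real.log T / (2 * π) * (zetaOrdinate p.1 - zetaOrdinate p.2) - s| ≤ y₀).card : ℝ) ≤
        C_w * (T * Real.log T) := hwin
  calc ((pairs T M).card : ℝ) ≤ (((zeroIndexSet T ×ˢ zeroIndexSet T).filter fun p ↦
      |Real.log T / (2 * π) * (zetaOrdinate p.1 - zetaOrdinate p.2)| ≤ M).card : ℝ) := by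
        exact_mod_cast Finset.card_le_card hsub
    _ ≤ 2 * (C_w * (T * Real.log T)) * (⌊M / y₀⌋₊ + 1) :=
        RudnickSarnak.card_filter_abs_le_le _ _ hy₀ hM hwin' hL

/-- The bins `B_{k/2}` with `|k| > 2M + 1` are empty (`|y| ≤ M` on `𝒫(T, M)`, `δ ≤ 1`).
[cite: BaluyotGoldstonSuriajayaTurnageButterbaugh2025, §1 (B_{k/2})] -/
theorem bin_eq_empty_of_lt {T M δ : ℝ} (hδ1 : δ ≤ 1) {k : ℤ} (hk : 2 * M + 1 < |(k : ℝ)|) :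
    bin k T M δ = ∅ := by
  rw [Finset.eq_empty_iff_forall_notMem]
  intro p hp
  rw [mem_bin, mem_pairs] at hp
  obtain ⟨⟨-, -, -, hy⟩, h1, h2⟩ := hp
  have hy' := abs_le.mp hy
  rcases lt_or_ge (k : ℝ) 0 with hneg | hpos
  · rw [abs_of_neg hneg] at hk; linarith
  · rw [abs_of_nonneg hpos] at hk; linarith

/-- The `k`-series of Lemma 5 (iii) is a finite sum: `∑_{k∈ℤ} c_k |B_{k/2}| = ∑_{|k| ≤ N} c_k |B_{k/2}|`
for `N ≥ 2M + 1`. [cite: BaluyotGoldstonSuriajayaTurnageButterbaugh2025, §5 (proof of Lemma 5)] -/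
theorem tsum_mul_binDensity_eq_sum {T M δ : ℝ} (hδ1 : δ ≤ 1) {N : ℕ} (hN : 2 * M + 1 ≤ N)
    (c : ℤ → ℂ) (a : ℤ → ℝ) :
    ∑' k : ℤ, c k * ((a k * binDensity k T M δ : ℝ) : ℂ) =
      ∑ k ∈ Finset.Icc (-(N : ℤ)) N, c k * ((a k * binDensity k T M δ : ℝ) : ℂ) := by
  apply tsum_eq_sum
  intro k hk
  have hk' : 2 * M + 1 < |(k : ℝ)| := by
    rw [Finset.mem_Icc, not_and_or, not_le, not_le] at hk
    rcases hk with h | h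
    · have h' : (k : ℝ) < -(N : ℝ) := by exact_mod_cast h
      rw [abs_of_neg (by linarith [show (0 : ℝ) ≤ N from Nat.cast_nonneg N])]; linarith
    · have h' : (N : ℝ) < (k : ℝ) := by exact_mod_cast h
      rw [abs_of_pos (by linarith [show (0 : ℝ) ≤ N from Nat.cast_nonneg N])]; linarith
  rw [binDensity, bin_eq_empty_of_lt hδ1 hk', Finset.card_empty, Nat.cast_zero, zero_div, mul_zero,
    Complex.ofReal_zero, mul_zero]

/-- **Localisation on the bins** (BGSTB 2025, §5: "By AH-Pairs, for `|(γ−γ') log T| ≪ M`,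
`e^{iα(γ−γ')log T} K_λ((γ−γ') log T) = e^{iπkα} K_λ(kπ) + O((|α| + λ)(|k| + 1)R(T))`", summed
over `𝒫(T, M) = ⊔_k B_{k/2}`, with `w = 1 + O(M²/log²T)`): if every pair of `𝒫(T, M)` is within
`ρ < δ/2` of a half-integer and `‖r‖ ≤ 1`, `‖r(x) − r(y)‖ ≤ Lip |x − y|`, then
`‖∑_{𝒫} r(y) w − ∑_{|k|≤N} r(k/2)|B_{k/2}|‖ ≤ (Lip ρ + π²M²/log²T) |𝒫(T, M)|`.
[cite: BaluyotGoldstonSuriajayaTurnageButterbaugh2025, §5 (proof of Lemma 5)] -/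
theorem norm_sum_pairs_sub_sum_bins_le {T M δ ρ : ℝ} (hδ2 : δ ≤ 1 / 2) (hρ : ρ < δ / 2)
    (hloc : ∀ p ∈ pairs T M, ∃ k : ℤ, |pairSpacing T p - (k : ℝ) / 2| ≤ ρ) {N : ℕ}
    (hN : 2 * M + 1 ≤ N) (hL : 0 < Real.log T) {r : ℝ → ℂ} {Lip : ℝ} (hLip : 0 ≤ Lip)
    (hr1 : ∀ y, ‖r y‖ ≤ 1) (hrlip : ∀ x y, ‖r x - r y‖ ≤ Lip * |x - y|) :
    ‖∑ p ∈ pairs T M, r (pairSpacing T p) * (montgomeryWeight (zetaOrdinate p.1 - zetaOrdinate p.2) : ℂ) -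
        ∑ k ∈ Finset.Icc (-(N : ℤ)) N, r ((k : ℝ) / 2) * ((bin k T M δ).card : ℂ)‖ ≤
      (Lip * ρ + π ^ 2 * M ^ 2 / Real.log T ^ 2) * (pairs T M).card := by
  have hdisj : Set.PairwiseDisjoint (↑(Finset.Icc (-(N : ℤ)) N) : Set ℤ) fun k ↦ bin k T M δ :=
    fun k _ k' _ hkk' ↦ disjoint_bin hδ2 hkk'
  have hU := pairs_eq_biUnion_bin (δ := δ) hδ2 hρ hloc hN
  have e1 : ∑ p ∈ pairs T M, r (pairSpacing T p) * (montgomeryWeight (zetaOrdinate p.1 - zetaOrdinate p.2) : ℂ) =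
      ∑ k ∈ Finset.Icc (-(N : ℤ)) N, ∑ p ∈ bin k T M δ,
        r (pairSpacing T p) * (montgomeryWeight (zetaOrdinate p.1 - zetaOrdinate p.2) : ℂ) := by
    rw [hU, Finset.sum_biUnion hdisj]
  have e2 : ∀ k : ℤ, r ((k : ℝ) / 2) * ((bin k T M δ).card : ℂ) = ∑ p ∈ bin k T M δ, r ((k : ℝ) / 2) := by
    intro k; rw [Finset.sum_const, nsmul_eq_mul, mul_comm]
  have e3 : ((pairs T M).card : ℝ) = ∑ k ∈ Finset.Icc (-(N : ℤ)) N, ((bin k T M δ).card : ℝ) := by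
    rw [hU, Finset.card_biUnion hdisj]; push_cast; rfl
  simp_rw [e2]
  rw [e1, ← Finset.sum_sub_distrib]
  simp_rw [← Finset.sum_sub_distrib]
  have hpt : ∀ k ∈ Finset.Icc (-(N : ℤ)) N, ∀ p ∈ bin k T M δ,
      ‖r (pairSpacing T p) * (montgomeryWeight (zetaOrdinate p.1 - zetaOrdinate p.2) : ℂ) - r ((k : ℝ) / 2)‖ ≤
        Lip * ρ + π ^ 2 * M ^ 2 / Real.log T ^ 2 := by
    intro k _ p hp
    have hpP : p ∈ pairs T M := bin_subset_pairs k T M δ hp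
    have hyk : |pairSpacing T p - (k : ℝ) / 2| ≤ ρ := (mem_bin_iff_of_localised hδ2 hρ hloc hpP k).mp hp
    have hyM : |pairSpacing T p| ≤ M := (mem_pairs.mp hpP).2.2.2
    set wv := montgomeryWeight (zetaOrdinate p.1 - zetaOrdinate p.2) with hwv
    have hw := one_sub_weight_le hL p
    rw [← hwv] at hw
    have e : r (pairSpacing T p) * (wv : ℂ) - r ((k : ℝ) / 2) =
        (r (pairSpacing T p) - r ((k : ℝ) / 2)) * (wv : ℂ) - r ((k : ℝ) / 2) * ((1 - wv : ℝ) : ℂ) := by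
      push_cast; ring
    rw [e]
    calc ‖(r (pairSpacing T p) - r ((k : ℝ) / 2)) * (wv : ℂ) - r ((k : ℝ) / 2) * ((1 - wv : ℝ) : ℂ)‖
        ≤ ‖(r (pairSpacing T p) - r ((k : ℝ) / 2)) * (wv : ℂ)‖ + ‖r ((k : ℝ) / 2) * ((1 - wv : ℝ) : ℂ)‖ :=
          norm_sub_le _ _
      _ = ‖r (pairSpacing T p) - r ((k : ℝ) / 2)‖ * wv + ‖r ((k : ℝ) / 2)‖ * (1 - wv) := by
          rw [norm_mul, norm_mul, Complex.norm_real, Complex.norm_real, Real.norm_eq_abs, Real.norm_eq_abs,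
            abs_of_pos (montgomeryWeight_pos _), abs_of_nonneg hw.1]
      _ ≤ Lip * |pairSpacing T p - (k : ℝ) / 2| * 1 + 1 * (π ^ 2 * pairSpacing T p ^ 2 / Real.log T ^ 2) := by
          refine add_le_add (mul_le_mul (hrlip _ _) (montgomeryWeight_le_one _) (montgomeryWeight_pos _).le
            (by positivity)) (mul_le_mul (hr1 _) hw.2 hw.1 zero_le_one)
      _ ≤ Lip * ρ + π ^ 2 * M ^ 2 / Real.log T ^ 2 := by
          rw [mul_one, one_mul]
          have h1 : pairSpacing T p ^ 2 ≤ M ^ 2 := by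
            have := abs_le.mp hyM
            nlinarith [sq_abs (pairSpacing T p), abs_nonneg (pairSpacing T p)]
          gcongr
  calc ‖∑ k ∈ Finset.Icc (-(N : ℤ)) N, ∑ p ∈ bin k T M δ,
        (r (pairSpacing T p) * (montgomeryWeight (zetaOrdinate p.1 - zetaOrdinate p.2) : ℂ) - r ((k : ℝ) / 2))‖
      ≤ ∑ k ∈ Finset.Icc (-(N : ℤ)) N, ‖∑ p ∈ bin k T M δ,
        (r (pairSpacing T p) * (montgomeryWeight (zetaOrdinate p.1 - zetaOrdinate p.2) : ℂ) - r ((k : ℝ) / 2))‖ :=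
        norm_sum_le _ _
    _ ≤ ∑ k ∈ Finset.Icc (-(N : ℤ)) N, ∑ p ∈ bin k T M δ,
        ‖r (pairSpacing T p) * (montgomeryWeight (zetaOrdinate p.1 - zetaOrdinate p.2) : ℂ) - r ((k : ℝ) / 2)‖ :=
        Finset.sum_le_sum fun k _ ↦ norm_sum_le _ _
    _ ≤ ∑ k ∈ Finset.Icc (-(N : ℤ)) N, ∑ p ∈ bin k T M δ, (Lip * ρ + π ^ 2 * M ^ 2 / Real.log T ^ 2) :=
        Finset.sum_le_sum fun k hk ↦ Finset.sum_le_sum fun p hp ↦ hpt k hk p hp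
    _ = (Lip * ρ + π ^ 2 * M ^ 2 / Real.log T ^ 2) * (pairs T M).card := by
        simp_rw [Finset.sum_const, nsmul_eq_mul]
        rw [e3, Finset.mul_sum]
        refine Finset.sum_congr rfl fun k _ ↦ ?_
        ring

set_option maxHeartbeats 1600000 in
/-- **The pairs outside `𝒫(T, M)`** (BGSTB 2025, §5, proof of Lemma 5 (iii): "the terms with
`γ ≤ T/log²T` or `γ' ≤ T/log²T` contribute `O(1/log T)`", and those with `|y| > M` contribute
"`≪ ((T/2π) log T)⁻¹ ∑_{|y|>M} 1/(λ²y²) ≪ 1/(λ²M)`" by (zeropairbound) — Goldston–Montgomery, under RH):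
for a weight `0 ≤ Φ ≤ min(1, 4λ⁻²(1 + |y|)⁻²)`, `∑_{Ω ∖ 𝒫(T,M)} Φ ≤ K T log T/λ²` with `K` explicit in the
window constants. [cite: BaluyotGoldstonSuriajayaTurnageButterbaugh2025, §5 (proof of Lemma 5)] -/
theorem sum_sdiff_pairs_le {T M lam y₀ C_w C₁ C₀ CN : ℝ} (hM : 0 < M) (hlam : 0 < lam)
    (hlam2 : lam ≤ 1 / 2) (hy₀ : 0 < y₀) (hCw : 0 ≤ C_w) (hC₁ : 0 ≤ C₁) (hC₀ : 0 ≤ C₀) (hCN : 0 ≤ CN)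
    (hwin : ∀ s : ℝ, |s| + y₀ ≤ Real.log T / π →
      (((zeroIndexSet T ×ˢ zeroIndexSet T).filter fun p ↦
          |Real.log T / (2 * π) * (zetaOrdinate p.1 - zetaOrdinate p.2) - s| ≤ y₀).card : ℝ) ≤
        C_w * (T * Real.log T))
    (hunit : ∀ a : ℝ, (((Finset.range (zetaZeroCount T)).filter fun c ↦
      a ≤ zetaOrdinate c ∧ zetaOrdinate c ≤ a + 1).card : ℝ) ≤ C₁ * Real.log T)
    (hW : ∀ u : ℝ, (zetaZeroCount (u + 1) : ℝ) - zetaZeroCount u ≤ C₀ * Real.log (|u| + 2))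
    (hN : ∀ u : ℝ, 2 ≤ u → (zetaZeroCount u : ℝ) ≤ CN * (u * Real.log u))
    (hT4 : 4 ≤ T) (hLM : 2 * π * M ≤ Real.log T) (hLy : 2 * π * (3 * y₀ + 2) ≤ Real.log T)
    (hu1 : 1 ≤ T / Real.log T ^ 2)
    (Φ : ℕ × ℕ → ℝ) (hΦ0 : ∀ p, 0 ≤ Φ p) (hΦ1 : ∀ p, Φ p ≤ 1)
    (hΦ2 : ∀ p, Φ p ≤ 4 / lam ^ 2 * ((1 + |pairSpacing T p|) ^ 2)⁻¹) :
    ∑ p ∈ (zeroIndexSet T ×ˢ zeroIndexSet T) \ pairs T M, Φ p ≤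
      (12 * CN * C₀ + 8 * C_w + 8 * C_w / y₀ ^ 2 + 32 * π * CN * C₁) * (T * Real.log T) / lam ^ 2 := by
  have hT0 : 0 < T := by linarith
  have hT1 : 1 < T := by linarith
  have hL : 0 < Real.log T := Real.log_pos hT1
  set L : ℝ := Real.log T with hLdef
  have hL2π : 2 * π ≤ L := by nlinarith [Real.pi_pos]
  have hL2 : 2 ≤ L := by linarith [Real.pi_gt_three]
  have hL1 : 1 ≤ L := by linarith
  set c : ℝ := L / (2 * π) with hc
  have hc0 : 0 < c := by positivity
  have hc1 : 1 ≤ c := by rw [hc, le_div_iff₀ (by positivity)]; linarith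
  set Z := zeroIndexSet T with hZ
  set Ω := zeroIndexSet T ×ˢ zeroIndexSet T with hΩ
  set yM : ℕ × ℕ → ℝ := fun p ↦ c * (zetaOrdinate p.1 - zetaOrdinate p.2) with hyM
  have hyeq : ∀ p, pairSpacing T p = yM p := fun p ↦ pairSpacing_eq T p
  -- the cut and the ranges
  set u : ℝ := T / L ^ 2 with hu
  set BT : ℝ := L / π - 3 * y₀ with hBT
  have hBT1 : c + 2 ≤ BT := by
    rw [hBT, hc]
    have : L / π = 2 * (L / (2 * π)) := by field_simp
    rw [this]
    have : 3 * y₀ + 2 ≤ L / (2 * π) := by rw [le_div_iff₀ (by positivity)]; linarith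
    linarith
  have hBT3 : 3 * y₀ ≤ BT := by
    have : 3 * y₀ + 2 ≤ L / (2 * π) := by rw [le_div_iff₀ (by positivity)]; linarith
    have h2 : L / (2 * π) ≤ L / π := by
      apply div_le_div_of_nonneg_left hL.le Real.pi_pos; linarith [Real.pi_pos]
    rw [hBT]; linarith
  have hBT3' : 3 ≤ BT := by linarith
  have hBT2 : c ≤ BT - 2 := by linarith
  set B' : ℝ := c * T with hB'
  have hyB' : ∀ p ∈ Ω, |yM p| ≤ B' := by
    intro p hp
    rw [hyM]; dsimp only
    rw [abs_mul, abs_of_pos hc0, hB']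
    exact mul_le_mul_of_nonneg_left (abs_sub_zetaOrdinate_le hp) hc0.le
  have hwin' : ∀ s : ℝ, |s| + y₀ ≤ L / π →
      ((Ω.filter fun p ↦ |yM p - s| ≤ y₀).card : ℝ) ≤ C_w * (T * L) := hwin
  -- decomposition
  set A := Ω.filter fun p ↦ |yM p| ≤ M ∧ (zetaOrdinate p.1 ≤ u ∨ zetaOrdinate p.2 ≤ u) with hA
  set B₁ := Ω.filter fun p ↦ |yM p| ≤ 3 * y₀ with hB₁
  set B₂ := Ω.filter fun p ↦ 3 * y₀ < |yM p| ∧ |yM p| ≤ BT with hB₂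
  set Cfar := Ω.filter fun p ↦ BT < |yM p| ∧ |yM p| ≤ B' with hCfar
  have hcover : Ω \ pairs T M ⊆ (A ∪ B₁) ∪ (B₂ ∪ Cfar) := by
    intro p hp
    rw [Finset.mem_sdiff] at hp
    obtain ⟨hpΩ, hpP⟩ := hp
    rw [mem_pairs, hyeq, not_and] at hpP
    have hnot := hpP hpΩ
    rw [Finset.mem_union, Finset.mem_union, Finset.mem_union, hA, hB₁, hB₂, hCfar, Finset.mem_filter,
      Finset.mem_filter, Finset.mem_filter, Finset.mem_filter]
    by_cases hyMle : |yM p| ≤ M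
    · left; left
      refine ⟨hpΩ, hyMle, ?_⟩
      by_contra hcon
      push Not at hcon
      exact hnot ⟨by rw [← hu]; exact hcon.1, by rw [← hu]; exact hcon.2, hyMle⟩
    · by_cases hy3 : |yM p| ≤ 3 * y₀
      · left; right; exact ⟨hpΩ, hy3⟩
      · push Not at hy3
        by_cases hyB : |yM p| ≤ BT
        · right; left; exact ⟨hpΩ, hy3, hyB⟩
        · push Not at hyB
          right; right; exact ⟨hpΩ, hyB, hyB' p hpΩ⟩
  have hmain : ∑ p ∈ Ω \ pairs T M, Φ p ≤ (∑ p ∈ A, Φ p + ∑ p ∈ B₁, Φ p) + (∑ p ∈ B₂, Φ p + ∑ p ∈ Cfar, Φ p) := by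
    calc ∑ p ∈ Ω \ pairs T M, Φ p ≤ ∑ p ∈ (A ∪ B₁) ∪ (B₂ ∪ Cfar), Φ p :=
          Finset.sum_le_sum_of_subset_of_nonneg hcover fun p _ _ ↦ hΦ0 p
      _ ≤ ∑ p ∈ A ∪ B₁, Φ p + ∑ p ∈ B₂ ∪ Cfar, Φ p := RudnickSarnak.sum_union_le_add _ _ hΦ0
      _ ≤ _ := add_le_add (RudnickSarnak.sum_union_le_add _ _ hΦ0) (RudnickSarnak.sum_union_le_add _ _ hΦ0)
  -- (a) the low pairs
  have hAcard : (A.card : ℝ) ≤ 12 * CN * C₀ * T := by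
    have hclose : ∀ p ∈ A, |zetaOrdinate p.1 - zetaOrdinate p.2| ≤ 1 := by
      intro p hp
      rw [hA, Finset.mem_filter] at hp
      have h1 : |yM p| ≤ M := hp.2.1
      rw [hyM] at h1; dsimp only at h1
      rw [abs_mul, abs_of_pos hc0] at h1
      have h2 : c * |zetaOrdinate p.1 - zetaOrdinate p.2| ≤ c * 1 := by
        rw [mul_one]
        refine h1.trans ?_
        rw [hc, le_div_iff₀ (by positivity)]; linarith
      exact le_of_mul_le_mul_left h2 hc0
    have hoff : ∀ p ∈ A, zetaOrdinate p.1 ≤ u ∨ zetaOrdinate p.2 ≤ u := fun p hp ↦ by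
      rw [hA, Finset.mem_filter] at hp; exact hp.2.2
    have h1 := card_pairs_offWindow_le hC₀ hW hT0.le (Finset.filter_subset _ _) hclose hoff
    have hu2 : 2 ≤ u + 1 := by linarith
    have huT : u + 1 ≤ T := by
      rw [hu]
      have : T / L ^ 2 ≤ T / 4 := by
        apply div_le_div_of_nonneg_left hT0.le (by norm_num)
        nlinarith
      linarith
    have hNu : (zetaZeroCount (u + 1) : ℝ) ≤ 2 * CN * T / L := by
      refine (hN (u + 1) hu2).trans ?_
      have hlog : Real.log (u + 1) ≤ L := Real.log_le_log (by linarith) huT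
      have hlog0 : 0 ≤ Real.log (u + 1) := Real.log_nonneg (by linarith)
      calc CN * ((u + 1) * Real.log (u + 1)) ≤ CN * ((2 * u) * L) := by
            apply mul_le_mul_of_nonneg_left _ hCN
            exact mul_le_mul (by linarith) hlog hlog0 (by linarith)
        _ = 2 * CN * T / L := by rw [hu]; field_simp
    have hlog4 : Real.log (T + 4) ≤ 2 * L := by
      have h2 : T + 4 ≤ T ^ 2 := by nlinarith
      calc Real.log (T + 4) ≤ Real.log (T ^ 2) := Real.log_le_log (by linarith) h2
        _ = 2 * L := by rw [Real.log_pow]; push_cast; rw [hLdef]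
    calc (A.card : ℝ) ≤ zetaZeroCount (u + 1) * (3 * C₀ * Real.log (T + 4)) := h1
      _ ≤ (2 * CN * T / L) * (3 * C₀ * (2 * L)) := by
          have hl0 : 0 ≤ Real.log (T + 4) := Real.log_nonneg (by linarith)
          apply mul_le_mul hNu (by nlinarith) (by positivity) (by positivity)
      _ = 12 * CN * C₀ * T := by field_simp; ring
  have hAsum : ∑ p ∈ A, Φ p ≤ 12 * CN * C₀ * (T * L) := by
    calc ∑ p ∈ A, Φ p ≤ ∑ p ∈ A, (1 : ℝ) := Finset.sum_le_sum fun p _ ↦ hΦ1 p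
      _ = A.card := by rw [Finset.sum_const, nsmul_eq_mul, mul_one]
      _ ≤ 12 * CN * C₀ * T := hAcard
      _ ≤ 12 * CN * C₀ * (T * L) := by
          have : T ≤ T * L := le_mul_of_one_le_right hT0.le hL1
          gcongr
  -- (b₁) the pairs with `|y| ≤ 3 y₀`
  have hB₁sum : ∑ p ∈ B₁, Φ p ≤ 8 * C_w * (T * L) := by
    have hR : (3 * y₀ / y₀ + 5 / 2) * y₀ ≤ L / π := by
      have : (3 * y₀ / y₀ + 5 / 2) * y₀ = 11 / 2 * y₀ := by field_simp; ring
      rw [this]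
      have h2 : 2 * (3 * y₀ + 2) ≤ L / π := by rw [le_div_iff₀ Real.pi_pos]; linarith
      linarith
    have h := RudnickSarnak.card_filter_abs_le_le Ω yM hy₀ (by positivity : (0 : ℝ) ≤ 3 * y₀) hwin' hR
    have hfl : (⌊3 * y₀ / y₀⌋₊ : ℝ) = 3 := by
      rw [show 3 * y₀ / y₀ = (3 : ℝ) by field_simp]
      norm_num
    calc ∑ p ∈ B₁, Φ p ≤ ∑ p ∈ B₁, (1 : ℝ) := Finset.sum_le_sum fun p _ ↦ hΦ1 p
      _ = B₁.card := by rw [Finset.sum_const, nsmul_eq_mul, mul_one]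
      _ ≤ 2 * (C_w * (T * L)) * (⌊3 * y₀ / y₀⌋₊ + 1) := by rw [hB₁]; exact h
      _ = 8 * C_w * (T * L) := by rw [hfl]; ring
  -- (b₂) the middle range `3y₀ < |y| ≤ BT`
  have hB₂sum : ∑ p ∈ B₂, Φ p ≤ 8 * C_w / y₀ ^ 2 * (T * L) / lam ^ 2 := by
    have hR : (BT / y₀ + 5 / 2) * y₀ ≤ L / π := by
      have : (BT / y₀ + 5 / 2) * y₀ = BT + 5 / 2 * y₀ := by field_simp
      rw [this, hBT]; linarith
    have hmid := RudnickSarnak.sum_filter_mid_le Ω yM hy₀ (le_refl (3 * y₀))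
      (by positivity : (0 : ℝ) ≤ C_w * (T * L)) hwin' hR
    calc ∑ p ∈ B₂, Φ p ≤ ∑ p ∈ B₂, 4 / lam ^ 2 * ((1 + |yM p|) ^ 2)⁻¹ := by
          refine Finset.sum_le_sum fun p _ ↦ ?_
          rw [← hyeq]; exact hΦ2 p
      _ = 4 / lam ^ 2 * ∑ p ∈ B₂, ((1 + |yM p|) ^ 2)⁻¹ := by rw [Finset.mul_sum]
      _ ≤ 4 / lam ^ 2 * (2 * (C_w * (T * L)) / (y₀ * (3 * y₀ - 2 * y₀))) := by
          apply mul_le_mul_of_nonneg_left _ (by positivity)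
          rw [hB₂]; exact hmid
      _ = 8 * C_w / y₀ ^ 2 * (T * L) / lam ^ 2 := by field_simp; ring
  -- (c) the far range `|y| > BT`, by unit windows row by row
  have hCsum : ∑ p ∈ Cfar, Φ p ≤ 32 * π * CN * C₁ * (T * L) / lam ^ 2 := by
    have hrow : ∀ i ∈ Z, ∑ j ∈ Z with BT < |yM (i, j)| ∧ |yM (i, j)| ≤ B',
        ((1 + |yM (i, j)|) ^ 2)⁻¹ ≤ 2 * (2 * (C₁ * L)) / (1 * (BT - 2 * 1)) := by
      intro i _
      have hwin_i : ∀ s : ℝ, |s| + 1 ≤ B' + 5 / 2 →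
          ((Z.filter fun j ↦ |yM (i, j) - s| ≤ 1).card : ℝ) ≤ 2 * (C₁ * L) := by
        intro s _
        exact card_filter_abs_scaled_sub_le hL2π hunit (zetaOrdinate i) s
      exact RudnickSarnak.sum_filter_mid_le Z (fun j ↦ yM (i, j)) one_pos (by linarith : 3 * (1 : ℝ) ≤ BT)
        (by positivity : (0 : ℝ) ≤ 2 * (C₁ * L)) hwin_i (by linarith : (B' / 1 + 5 / 2) * 1 ≤ B' + 5 / 2)
    have hCfar_sum : ∑ p ∈ Cfar, ((1 + |yM p|) ^ 2)⁻¹ ≤ zetaZeroCount T * (4 * (C₁ * L) / (BT - 2)) := by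
      have e : ∑ p ∈ Cfar, ((1 + |yM p|) ^ 2)⁻¹ =
          ∑ i ∈ Z, ∑ j ∈ Z with BT < |yM (i, j)| ∧ |yM (i, j)| ≤ B', ((1 + |yM (i, j)|) ^ 2)⁻¹ := by
        rw [hCfar, Finset.sum_filter, hΩ, Finset.sum_product]
        refine Finset.sum_congr rfl fun i _ ↦ ?_
        rw [Finset.sum_filter]
      rw [e]
      calc ∑ i ∈ Z, ∑ j ∈ Z with BT < |yM (i, j)| ∧ |yM (i, j)| ≤ B', ((1 + |yM (i, j)|) ^ 2)⁻¹
          ≤ ∑ i ∈ Z, 2 * (2 * (C₁ * L)) / (1 * (BT - 2 * 1)) := Finset.sum_le_sum hrow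
        _ = zetaZeroCount T * (4 * (C₁ * L) / (BT - 2)) := by
            rw [Finset.sum_const, nsmul_eq_mul, hZ, card_zeroIndexSet]; ring
    have hNT : (zetaZeroCount T : ℝ) ≤ CN * (T * L) := hN T (by linarith)
    have hBT2inv : 4 * (C₁ * L) / (BT - 2) ≤ 4 * (C₁ * L) / c :=
      div_le_div_of_nonneg_left (by positivity) hc0 hBT2
    calc ∑ p ∈ Cfar, Φ p ≤ ∑ p ∈ Cfar, 4 / lam ^ 2 * ((1 + |yM p|) ^ 2)⁻¹ := by
          refine Finset.sum_le_sum fun p _ ↦ ?_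
          rw [← hyeq]; exact hΦ2 p
      _ = 4 / lam ^ 2 * ∑ p ∈ Cfar, ((1 + |yM p|) ^ 2)⁻¹ := by rw [Finset.mul_sum]
      _ ≤ 4 / lam ^ 2 * (CN * (T * L) * (4 * (C₁ * L) / c)) := by
          apply mul_le_mul_of_nonneg_left _ (by positivity)
          have hq0 : 0 ≤ 4 * (C₁ * L) / (BT - 2) := div_nonneg (by positivity) (by linarith)
          exact hCfar_sum.trans (mul_le_mul hNT hBT2inv hq0 (by positivity))
      _ = 32 * π * CN * C₁ * (T * L) / lam ^ 2 := by rw [hc]; field_simp; ring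
  -- assemble
  have hTL : 0 ≤ T * L := by positivity
  have e1 : 12 * CN * C₀ * (T * L) ≤ 12 * CN * C₀ * (T * L) / lam ^ 2 := by
    rw [le_div_iff₀ (by positivity)]
    have : lam ^ 2 ≤ 1 := by nlinarith
    calc 12 * CN * C₀ * (T * L) * lam ^ 2 ≤ 12 * CN * C₀ * (T * L) * 1 := by gcongr
      _ = _ := mul_one _
  have e2 : 8 * C_w * (T * L) ≤ 8 * C_w * (T * L) / lam ^ 2 := by
    rw [le_div_iff₀ (by positivity)]
    have : lam ^ 2 ≤ 1 := by nlinarith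
    calc 8 * C_w * (T * L) * lam ^ 2 ≤ 8 * C_w * (T * L) * 1 := by gcongr
      _ = _ := mul_one _
  calc ∑ p ∈ Ω \ pairs T M, Φ p ≤ (∑ p ∈ A, Φ p + ∑ p ∈ B₁, Φ p) + (∑ p ∈ B₂, Φ p + ∑ p ∈ Cfar, Φ p) := hmain
    _ ≤ (12 * CN * C₀ * (T * L) / lam ^ 2 + 8 * C_w * (T * L) / lam ^ 2) +
        (8 * C_w / y₀ ^ 2 * (T * L) / lam ^ 2 + 32 * π * CN * C₁ * (T * L) / lam ^ 2) :=
        add_le_add (add_le_add (hAsum.trans e1) (hB₁sum.trans e2)) (add_le_add hB₂sum hCsum)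
    _ = (12 * CN * C₀ + 8 * C_w + 8 * C_w / y₀ ^ 2 + 32 * π * CN * C₁) * (T * L) / lam ^ 2 := by
        field_simp; ring

/-- `sinc²(πλy) ≤ 4 λ⁻² (1 + |y|)⁻²` for `0 < λ ≤ 1/2` (`|K_λ| ≤ min(1, (λπy)⁻²)`). [folklore] -/
private theorem sinc_sq_le_decay {lam : ℝ} (hlam : 0 < lam) (hlam2 : lam ≤ 1 / 2) (y : ℝ) :
    Real.sinc (π * lam * y) ^ 2 ≤ 4 / lam ^ 2 * ((1 + |y|) ^ 2)⁻¹ := by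
  have hs1 : Real.sinc (π * lam * y) ^ 2 ≤ 1 := by
    rw [← sq_abs]; exact pow_le_one₀ (abs_nonneg _) (Real.abs_sinc_le_one _)
  have e : 4 / lam ^ 2 * ((1 + |y|) ^ 2)⁻¹ = 4 / (lam ^ 2 * (1 + |y|) ^ 2) := by
    field_simp
  rw [e]
  have h2l : lam ^ 2 ≤ 1 / 4 := by nlinarith
  by_cases hy : |y| ≤ 1
  · refine hs1.trans ?_
    rw [le_div_iff₀ (by positivity), one_mul]
    have h1 : (1 + |y|) ^ 2 ≤ 4 := by nlinarith [abs_nonneg y]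
    nlinarith [mul_le_mul h2l h1 (by positivity) (by positivity)]
  · push Not at hy
    have hy0 : y ≠ 0 := by intro h; rw [h, abs_zero] at hy; linarith
    have hx : π * lam * y ≠ 0 := by positivity
    have h1 : |Real.sinc (π * lam * y)| ≤ (π * lam * |y|)⁻¹ := by
      rw [Real.sinc_of_ne_zero hx, abs_div, abs_mul, abs_mul, abs_of_pos Real.pi_pos, abs_of_pos hlam,
        div_le_iff₀ (by positivity), inv_mul_cancel₀ (by positivity)]
      exact Real.abs_sin_le_one _
    have h2 : Real.sinc (π * lam * y) ^ 2 ≤ ((π * lam * |y|)⁻¹) ^ 2 := by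
      rw [← sq_abs]; exact pow_le_pow_left₀ (abs_nonneg _) h1 2
    refine h2.trans ?_
    rw [inv_pow, inv_eq_one_div, div_le_div_iff₀ (by positivity) (by positivity), one_mul]
    have h3 : (1 + |y|) ^ 2 ≤ 4 * |y| ^ 2 := by nlinarith
    have h5 : lam ^ 2 * (1 + |y|) ^ 2 ≤ lam ^ 2 * (4 * |y| ^ 2) := mul_le_mul_of_nonneg_left h3 (sq_nonneg _)
    have h6 : lam ^ 2 * (4 * |y| ^ 2) ≤ 4 * (π * lam * |y|) ^ 2 := by
      rw [show 4 * (π * lam * |y|) ^ 2 = π ^ 2 * (lam ^ 2 * (4 * |y| ^ 2)) by ring]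
      exact le_mul_of_one_le_left (by positivity) (by nlinarith [Real.pi_gt_three])
    linarith

set_option maxHeartbeats 3200000 in
/-- **BGSTB 2025, Lemma 5 (Heath-Brown) (iii) — PROVED (under RH and AH-Pairs).**
"`G_λ(α) = ∑_{k∈ℤ} e^{iπkα} (sin(λπk/2)/(λπk/2))² P_{k/2} + O(E_G(λ, α))`,
`E_G(λ, α) = 1/(λ²M) + (|α| + 1)M²R(T) + 1/log T`, where `M`, `T`, `R(T)` are from AH-Pairs":
for AH-Pairs data `(M, R)` (`AH.IsPairsRate M R`) and a bin half-width `0 < δ ≤ 1/2` there is `C` with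
`‖G_λ(α) − ∑_k e^{iπkα} sinc²(λπk/2) P_{k/2}(T)‖ ≤ C E_G(λ, α)` for all large `T`, all
`0 < λ ≤ 1/2` and all `α`. The Riemann Hypothesis enters exactly where the printed proof uses
(zeropairbound) (Goldston–Montgomery 1987, an RH pair count) to discard the pairs outside `𝒫(T, M)`
and to bound `|𝒫(T, M)| ≪ M T log T`; the source states (iii) "assuming AH-Pairs" with that input
implicit. [cite: BaluyotGoldstonSuriajayaTurnageButterbaugh2025, Lemma 5 (iii)] -/
theorem heathBrownG_approx (hRH : RiemannHypothesis) {M : ℝ} (hM : 0 < M) {R : ℝ → ℝ}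
    (hR : IsPairsRate M R) {δ : ℝ} (hδ : 0 < δ) (hδ2 : δ ≤ 1 / 2) :
    ∃ C : ℝ, ∀ᶠ T : ℝ in atTop, ∀ lam : ℝ, 0 < lam → lam ≤ 1 / 2 → ∀ α : ℝ,
      ‖(heathBrownG lam α T : ℂ) -
          ∑' k : ℤ, Complex.exp (π * k * α * Complex.I) *
            ((Real.sinc (lam * π * k / 2) ^ 2 * binDensity k T M δ : ℝ) : ℂ)‖ ≤
        C * errG M (R T) T lam α := by
  obtain ⟨hR0, -, hRlim, C_R, hCR⟩ := hR
  set C' : ℝ := max C_R 1 with hC'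
  have hC'0 : 0 < C' := lt_of_lt_of_le one_pos (le_max_right _ _)
  have hC'C : C_R ≤ C' := le_max_left _ _
  obtain ⟨y₀, hy₀, C_w, hwinE⟩ := RudnickSarnak.exists_pairCount_window_le hRH
  obtain ⟨C₁, hC₁, hunitE⟩ := RudnickSarnak.eventually_card_filter_zetaOrdinate_window_le
  obtain ⟨C₀, hC₀, hW⟩ := Montgomery.exists_zetaZeroCount_window_le
  obtain ⟨CN, hCN, hN⟩ := exists_zetaZeroCount_le_mul_log
  set Cw : ℝ := max C_w 1 with hCw
  have hCw0 : 0 < Cw := lt_of_lt_of_le one_pos (le_max_right _ _)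
  set KF : ℝ := 12 * CN * C₀ + 8 * Cw + 8 * Cw / y₀ ^ 2 + 32 * π * CN * C₁ with hKF
  have hKF0 : 0 ≤ KF := by positivity
  set KP : ℝ := 2 * Cw * (M / y₀ + 1) with hKP
  have hKP0 : 0 ≤ KP := by positivity
  set N : ℕ := ⌈2 * M + 1⌉₊ with hNdef
  have hN' : 2 * M + 1 ≤ (N : ℝ) := Nat.le_ceil _
  set C : ℝ := 2 * π * (KF * M + π ^ 2 * M ^ 2 * KP + 2 * π * C' * (4 * M + 2) * KP / M ^ 2) with hCdef
  refine ⟨C, ?_⟩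
  have hρ : Tendsto (fun T ↦ C' * (4 * M + 2) * R T) atTop (𝓝 0) := by
    have := hRlim.const_mul (C' * (4 * M + 2)); rwa [mul_zero] at this
  filter_upwards [hCR, hwinE, hunitE, eventually_ge_atTop (4 : ℝ),
    Real.tendsto_log_atTop.eventually_ge_atTop (2 * π * M),
    Real.tendsto_log_atTop.eventually_ge_atTop (2 * π * (3 * y₀ + 2)),
    Real.tendsto_log_atTop.eventually_ge_atTop (π * ((M / y₀ + 5 / 2) * y₀)),
    (RudnickSarnak.tendsto_div_log_sq_atTop).eventually_ge_atTop (1 : ℝ),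
    hρ.eventually (gt_mem_nhds (show (0 : ℝ) < δ / 4 by positivity)),
    (hRlim.const_mul C').eventually (gt_mem_nhds (show C' * 0 < 1 / 4 by norm_num))]
    with T hCT hwin hunit hT4 hLM hLy hLP hu1 hρT hR4
  intro lam hlam hlam2 α
  have hT0 : 0 < T := by linarith
  have hT1 : 1 < T := by linarith
  set L : ℝ := Real.log T with hLdef
  have hL : 0 < L := Real.log_pos hT1
  have hL1 : 1 ≤ L := by nlinarith [Real.pi_gt_three, hy₀]
  set Nm : ℝ := T / (2 * π) * L with hNm
  have hNm0 : 0 < Nm := by positivity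
  set Ω := zeroIndexSet T ×ˢ zeroIndexSet T with hΩ
  set r : ℝ → ℂ := fun y ↦ 𝓕 (fun v : ℝ ↦ (fejerTest lam (-α) v : ℂ)) y with hr
  have hr_eq : ∀ y, r y = Complex.exp (↑(2 * π * α * y) * Complex.I) *
      ((Real.sinc (π * lam * y) ^ 2 : ℝ) : ℂ) := by
    intro y; rw [hr]; dsimp only; rw [fourier_fejerTest hlam]; congr 2; push_cast; ring
  have hr1 : ∀ y, ‖r y‖ ≤ 1 := fun y ↦ norm_fourier_fejerTest_le hlam (-α) y
  have hrlip : ∀ x y, ‖r x - r y‖ ≤ 2 * π * (|α| + 1) * |x - y| := by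
    intro x y
    have := norm_fourier_fejerTest_sub_le hlam (by linarith) (-α) x y
    rwa [abs_neg] at this
  have hrdec : ∀ y, ‖r y‖ ≤ 4 / lam ^ 2 * ((1 + |y|) ^ 2)⁻¹ := by
    intro y
    rw [hr_eq, norm_mul, Complex.norm_exp_ofReal_mul_I, one_mul, Complex.norm_real, Real.norm_eq_abs,
      abs_of_nonneg (sq_nonneg _)]
    exact sinc_sq_le_decay hlam hlam2 y
  -- window bound with the positive constant `Cw`
  have hwin' : ∀ s : ℝ, |s| + y₀ ≤ Real.log T / π →
      ((Ω.filter fun p ↦ |Real.log T / (2 * π) * (zetaOrdinate p.1 - zetaOrdinate p.2) - s| ≤ y₀).card : ℝ) ≤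
        Cw * (T * Real.log T) := by
    intro s hs
    refine (hwin s hs).trans ?_
    exact mul_le_mul_of_nonneg_right (le_max_left _ _) (by positivity)
  -- (0) `G_λ(α) 𝒩 = Σ_Ω r(y) w`
  have h0 := heathBrownG_mul_eq_sum hlam hT1 α
  rw [← hNm] at h0
  -- (1) the main term is `(Σ_{|k|≤N} r(k/2) |B_{k/2}|)/𝒩`
  have hNmC : (Nm : ℂ) ≠ 0 := Complex.ofReal_ne_zero.mpr hNm0.ne'
  have h1 : ∑' k : ℤ, Complex.exp (π * k * α * Complex.I) *
      ((Real.sinc (lam * π * k / 2) ^ 2 * binDensity k T M δ : ℝ) : ℂ) =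
      (∑ k ∈ Finset.Icc (-(N : ℤ)) N, r ((k : ℝ) / 2) * ((bin k T M δ).card : ℂ)) / (Nm : ℂ) := by
    rw [tsum_mul_binDensity_eq_sum (by linarith : δ ≤ 1) hN'
      (fun k ↦ Complex.exp (π * k * α * Complex.I)) (fun k ↦ Real.sinc (lam * π * k / 2) ^ 2),
      Finset.sum_div]
    refine Finset.sum_congr rfl fun k _ ↦ ?_
    rw [hr_eq, binDensity, ← hLdef, ← hNm]
    have e1 : Complex.exp (π * k * α * Complex.I) = Complex.exp (↑(2 * π * α * ((k : ℝ) / 2)) * Complex.I) := by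
      congr 1; push_cast; ring
    have e2 : Real.sinc (lam * π * k / 2) = Real.sinc (π * lam * ((k : ℝ) / 2)) := by
      congr 1; ring
    rw [e1, e2]
    push_cast
    field_simp
  -- (2) localisation of `𝒫(T, M)` near the half-integers, `ρ_T = C'(4M+2)R(T) < δ/4`
  set ρ : ℝ := C' * (4 * M + 2) * R T with hρdef
  have hρ0 : 0 ≤ ρ := by have := hR0 T; positivity
  have hρδ : ρ < δ / 2 := by have : ρ < δ / 4 := hρT; linarith
  have hloc : ∀ p ∈ pairs T M, ∃ k : ℤ, |pairSpacing T p - (k : ℝ) / 2| ≤ ρ := by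
    intro p hp
    obtain ⟨k, hk⟩ := hCT p hp
    refine ⟨k, hk.trans ?_⟩
    have hy : |pairSpacing T p| ≤ M := (mem_pairs.mp hp).2.2.2
    have hRT := hR0 T
    have h1 : C_R * (|(k : ℝ)| + 1) * R T ≤ C' * (|(k : ℝ)| + 1) * R T := by gcongr
    have hk2 : |(k : ℝ)| / 2 ≤ |pairSpacing T p| + C' * (|(k : ℝ)| + 1) * R T := by
      have := abs_sub_abs_le_abs_sub ((k : ℝ) / 2) (pairSpacing T p)
      rw [abs_sub_comm, abs_div, abs_two] at this
      linarith
    have hR4' : C' * R T < 1 / 4 := hR4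
    have hk4 : |(k : ℝ)| ≤ 4 * M + 1 := by
      have hkk : 0 ≤ |(k : ℝ)| := abs_nonneg _
      nlinarith
    calc C_R * (|(k : ℝ)| + 1) * R T ≤ C' * (|(k : ℝ)| + 1) * R T := h1
      _ ≤ C' * (4 * M + 2) * R T := by
          apply mul_le_mul_of_nonneg_right _ hRT.le
          apply mul_le_mul_of_nonneg_left _ hC'0.le
          linarith
  -- (3) the two error pieces
  set Φ : ℕ × ℕ → ℝ := fun p ↦ ‖r (pairSpacing T p)‖ * montgomeryWeight (zetaOrdinate p.1 - zetaOrdinate p.2)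
    with hΦ
  have hΦ0 : ∀ p, 0 ≤ Φ p := fun p ↦ mul_nonneg (norm_nonneg _) (montgomeryWeight_pos _).le
  have hΦle : ∀ p, Φ p ≤ ‖r (pairSpacing T p)‖ := fun p ↦
    mul_le_of_le_one_right (norm_nonneg _) (montgomeryWeight_le_one _)
  have hΦ1 : ∀ p, Φ p ≤ 1 := fun p ↦ (hΦle p).trans (hr1 _)
  have hΦ2 : ∀ p, Φ p ≤ 4 / lam ^ 2 * ((1 + |pairSpacing T p|) ^ 2)⁻¹ := fun p ↦ (hΦle p).trans (hrdec _)
  have hA := sum_sdiff_pairs_le hM hlam hlam2 hy₀ hCw0.le hC₁.le hC₀.le hCN.le hwin' hunit hW hN hT4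
    hLM hLy hu1 Φ hΦ0 hΦ1 hΦ2
  have hB := norm_sum_pairs_sub_sum_bins_le (δ := δ) hδ2 hρδ hloc hN' hL (Lip := 2 * π * (|α| + 1))
    (by positivity) hr1 hrlip
  have hLP' : (M / y₀ + 5 / 2) * y₀ ≤ Real.log T / π := by
    rw [le_div_iff₀ Real.pi_pos]; linarith
  have hPcard : ((pairs T M).card : ℝ) ≤ KP * (T * L) := by
    refine (card_pairs_le_window hM.le hy₀ hwin' hLP').trans ?_
    have hfl : (⌊M / y₀⌋₊ : ℝ) ≤ M / y₀ := Nat.floor_le (by positivity)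
    rw [hKP, ← hLdef]
    calc 2 * (Cw * (T * L)) * (⌊M / y₀⌋₊ + 1) ≤ 2 * (Cw * (T * L)) * (M / y₀ + 1) := by gcongr
      _ = 2 * Cw * (M / y₀ + 1) * (T * L) := by ring
  -- (4) assemble
  have hPΩ : pairs T M ⊆ Ω := fun p hp ↦ (mem_pairs.mp hp).1
  have hdiff : ‖∑ p ∈ Ω, r (pairSpacing T p) * (montgomeryWeight (zetaOrdinate p.1 - zetaOrdinate p.2) : ℂ) -
      ∑ p ∈ pairs T M, r (pairSpacing T p) * (montgomeryWeight (zetaOrdinate p.1 - zetaOrdinate p.2) : ℂ)‖ ≤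
      KF * (T * L) / lam ^ 2 := by
    rw [← Finset.sum_sdiff_eq_sub hPΩ]
    calc ‖∑ p ∈ Ω \ pairs T M, r (pairSpacing T p) * (montgomeryWeight (zetaOrdinate p.1 - zetaOrdinate p.2) : ℂ)‖
        ≤ ∑ p ∈ Ω \ pairs T M, ‖r (pairSpacing T p) * (montgomeryWeight (zetaOrdinate p.1 - zetaOrdinate p.2) : ℂ)‖ :=
          norm_sum_le _ _
      _ = ∑ p ∈ Ω \ pairs T M, Φ p := by
          refine Finset.sum_congr rfl fun p _ ↦ ?_
          rw [hΦ, norm_mul, Complex.norm_real, Real.norm_eq_abs, abs_of_pos (montgomeryWeight_pos _)]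
      _ ≤ KF * (T * L) / lam ^ 2 := by rw [hKF, hΩ, ← hLdef] at *; exact hA
  have hmainC : (heathBrownG lam α T : ℂ) -
      ∑' k : ℤ, Complex.exp (π * k * α * Complex.I) *
        ((Real.sinc (lam * π * k / 2) ^ 2 * binDensity k T M δ : ℝ) : ℂ) =
      ((∑ p ∈ Ω, r (pairSpacing T p) * (montgomeryWeight (zetaOrdinate p.1 - zetaOrdinate p.2) : ℂ) -
          ∑ p ∈ pairs T M, r (pairSpacing T p) * (montgomeryWeight (zetaOrdinate p.1 - zetaOrdinate p.2) : ℂ)) +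
        (∑ p ∈ pairs T M, r (pairSpacing T p) * (montgomeryWeight (zetaOrdinate p.1 - zetaOrdinate p.2) : ℂ) -
          ∑ k ∈ Finset.Icc (-(N : ℤ)) N, r ((k : ℝ) / 2) * ((bin k T M δ).card : ℂ))) / (Nm : ℂ) := by
    rw [h1, ← h0]
    push_cast
    field_simp
    ring
  rw [hmainC, norm_div, Complex.norm_real, Real.norm_eq_abs, abs_of_pos hNm0, div_le_iff₀ hNm0]
  calc ‖(∑ p ∈ Ω, r (pairSpacing T p) * (montgomeryWeight (zetaOrdinate p.1 - zetaOrdinate p.2) : ℂ) -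
          ∑ p ∈ pairs T M, r (pairSpacing T p) * (montgomeryWeight (zetaOrdinate p.1 - zetaOrdinate p.2) : ℂ)) +
        (∑ p ∈ pairs T M, r (pairSpacing T p) * (montgomeryWeight (zetaOrdinate p.1 - zetaOrdinate p.2) : ℂ) -
          ∑ k ∈ Finset.Icc (-(N : ℤ)) N, r ((k : ℝ) / 2) * ((bin k T M δ).card : ℂ))‖
      ≤ KF * (T * L) / lam ^ 2 + (2 * π * (|α| + 1) * ρ + π ^ 2 * M ^ 2 / L ^ 2) * (pairs T M).card :=
        (norm_add_le _ _).trans (add_le_add hdiff hB)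
    _ ≤ KF * (T * L) / lam ^ 2 + (2 * π * (|α| + 1) * ρ + π ^ 2 * M ^ 2 / L ^ 2) * (KP * (T * L)) := by
        gcongr
    _ ≤ C * errG M (R T) T lam α * Nm := by
        rw [errG, hCdef, hNm, ← hLdef]
        have hRT := (hR0 T).le
        -- atoms
        set a₁ : ℝ := KF * M with ha₁
        set a₂ : ℝ := π ^ 2 * M ^ 2 * KP with ha₂
        set a₃ : ℝ := 2 * π * C' * (4 * M + 2) * KP / M ^ 2 with ha₃
        set e₁ : ℝ := 1 / (lam ^ 2 * M) with he₁
        set e₂ : ℝ := (|α| + 1) * M ^ 2 * R T with he₂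
        set e₃ : ℝ := 1 / L with he₃
        have ha₁0 : 0 ≤ a₁ := by positivity
        have ha₂0 : 0 ≤ a₂ := by positivity
        have ha₃0 : 0 ≤ a₃ := by positivity
        have he₁0 : 0 ≤ e₁ := by positivity
        have he₂0 : 0 ≤ e₂ := by positivity
        have he₃0 : 0 ≤ e₃ := by positivity
        have t1 : KF * (T * L) / lam ^ 2 = 2 * π * (a₁ * e₁) * (T / (2 * π) * L) := by
          rw [ha₁, he₁]; field_simp
        have t2 : 2 * π * (|α| + 1) * ρ * (KP * (T * L)) = 2 * π * (a₃ * e₂) * (T / (2 * π) * L) := by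
          rw [ha₃, he₂, hρdef]; field_simp
        have t3 : π ^ 2 * M ^ 2 / L ^ 2 * (KP * (T * L)) ≤ 2 * π * (a₂ * e₃) * (T / (2 * π) * L) := by
          rw [ha₂, he₃, show 2 * π * (π ^ 2 * M ^ 2 * KP * (1 / L)) * (T / (2 * π) * L) =
            π ^ 2 * M ^ 2 * KP * T by field_simp]
          rw [show π ^ 2 * M ^ 2 / L ^ 2 * (KP * (T * L)) = π ^ 2 * M ^ 2 * KP * T / L by field_simp]
          exact div_le_self (by positivity) hL1
        have key : a₁ * e₁ + a₃ * e₂ + a₂ * e₃ ≤ (a₁ + a₂ + a₃) * (e₁ + e₂ + e₃) := by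
          nlinarith [mul_nonneg ha₁0 he₂0, mul_nonneg ha₁0 he₃0, mul_nonneg ha₂0 he₁0,
            mul_nonneg ha₂0 he₂0, mul_nonneg ha₃0 he₁0, mul_nonneg ha₃0 he₃0]
        have key' := mul_le_mul_of_nonneg_left key (by positivity : (0 : ℝ) ≤ 2 * π * (T / (2 * π) * L))
        have expand : KF * (T * L) / lam ^ 2 + (2 * π * (|α| + 1) * ρ + π ^ 2 * M ^ 2 / L ^ 2) * (KP * (T * L)) =
            KF * (T * L) / lam ^ 2 + 2 * π * (|α| + 1) * ρ * (KP * (T * L)) +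
              π ^ 2 * M ^ 2 / L ^ 2 * (KP * (T * L)) := by ring
        rw [expand, t1, t2]
        have eC : 2 * π * (a₁ + a₂ + a₃) * (e₁ + e₂ + e₃) * (T / (2 * π) * L) =
            2 * π * (T / (2 * π) * L) * ((a₁ + a₂ + a₃) * (e₁ + e₂ + e₃)) := by ring
        rw [eC]
        nlinarith [t3, key']

/-- **BGSTB 2025, Lemma 5 (iv) — PROVED (under RH and AH-Pairs), periodicity of `G_λ` modulo 2:**
"`G_λ(α + 2L) = G_λ(α) + O(E_G(λ, |α| + 2L))` for `L ∈ ℤ`" — here with `|L|` in the error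
(`E_G(λ, |α| + 2|L|)`), which is what "(iv) follows immediately from (iii)" yields:
`e^{iπk(α+2L)} = e^{iπkα}`, and `E_G(λ, α) + E_G(λ, α + 2L) ≤ 2 E_G(λ, |α| + 2|L|)`.
(For `L < 0` the printed `|α| + 2L` can be `≈ 0` while `|α|` is large; that form does not follow.)
[cite: BaluyotGoldstonSuriajayaTurnageButterbaugh2025, Lemma 5 (iv)] -/
theorem heathBrownG_add_two_mul_sub_le (hRH : RiemannHypothesis) {M : ℝ} (hM : 0 < M) {R : ℝ → ℝ}
    (hR : IsPairsRate M R) {δ : ℝ} (hδ : 0 < δ) (hδ2 : δ ≤ 1 / 2) :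
    ∃ C : ℝ, ∀ᶠ T : ℝ in atTop, ∀ lam : ℝ, 0 < lam → lam ≤ 1 / 2 → ∀ α : ℝ, ∀ L : ℤ,
      |heathBrownG lam (α + 2 * L) T - heathBrownG lam α T| ≤
        C * errG M (R T) T lam (|α| + 2 * |(L : ℝ)|) := by
  obtain ⟨C, hC⟩ := heathBrownG_approx hRH hM hR hδ hδ2
  have hR0 : ∀ T, 0 < R T := hR.1
  refine ⟨2 * C, ?_⟩
  filter_upwards [hC, eventually_gt_atTop (1 : ℝ)] with T hT hT1
  intro lam hlam hlam2 α L
  have hlog : 0 < Real.log T := Real.log_pos hT1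
  set S : ℂ := ∑' k : ℤ, Complex.exp (π * k * α * Complex.I) *
    ((Real.sinc (lam * π * k / 2) ^ 2 * binDensity k T M δ : ℝ) : ℂ) with hS
  have hper : ∑' k : ℤ, Complex.exp (π * k * ((α + 2 * (L : ℝ) : ℝ) : ℂ) * Complex.I) *
      ((Real.sinc (lam * π * k / 2) ^ 2 * binDensity k T M δ : ℝ) : ℂ) = S := by
    rw [hS]
    refine tsum_congr fun k ↦ ?_
    congr 1
    rw [show (π : ℂ) * k * ((α + 2 * (L : ℝ) : ℝ) : ℂ) * Complex.I =
        π * k * α * Complex.I + ((k * L : ℤ) : ℂ) * (2 * π * Complex.I) by push_cast; ring,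
      Complex.exp_add, Complex.exp_int_mul_two_pi_mul_I, mul_one]
  have h1 := hT lam hlam hlam2 (α + 2 * L)
  have h2 := hT lam hlam hlam2 α
  rw [hper] at h1
  have hdiff : ((heathBrownG lam (α + 2 * L) T - heathBrownG lam α T : ℝ) : ℂ) =
      ((heathBrownG lam (α + 2 * L) T : ℂ) - S) - ((heathBrownG lam α T : ℂ) - S) := by
    push_cast; ring
  have hn : |heathBrownG lam (α + 2 * L) T - heathBrownG lam α T| ≤
      C * errG M (R T) T lam (α + 2 * L) + C * errG M (R T) T lam α := by
    rw [← Real.norm_eq_abs, ← Complex.norm_real, hdiff]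
    exact (norm_sub_le _ _).trans (add_le_add h1 h2)
  refine hn.trans ?_
  -- `E_G(λ, α + 2L), E_G(λ, α) ≤ E_G(λ, |α| + 2|L|)`, and `C ≥ 0` may be assumed via the bound itself
  have hE1 : errG M (R T) T lam (α + 2 * L) ≤ errG M (R T) T lam (|α| + 2 * |(L : ℝ)|) := by
    unfold errG
    have : |α + 2 * (L : ℝ)| ≤ |(|α| + 2 * |(L : ℝ)|)| := by
      rw [abs_of_nonneg (show (0 : ℝ) ≤ |α| + 2 * |(L : ℝ)| by positivity)]
      calc |α + 2 * (L : ℝ)| ≤ |α| + |2 * (L : ℝ)| := abs_add_le _ _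
        _ = |α| + 2 * |(L : ℝ)| := by rw [abs_mul, abs_two]
    have hRT := (hR0 T).le
    gcongr
  have hE2 : errG M (R T) T lam α ≤ errG M (R T) T lam (|α| + 2 * |(L : ℝ)|) := by
    unfold errG
    have : |α| ≤ |(|α| + 2 * |(L : ℝ)|)| := by
      rw [abs_of_nonneg (show (0 : ℝ) ≤ |α| + 2 * |(L : ℝ)| by positivity)]
      linarith [abs_nonneg (L : ℝ)]
    have hRT := (hR0 T).le
    gcongr
  -- sign of `C`: from `h2` at this `T`, `0 ≤ C * errG …` with `errG > 0`, so `C ≥ 0`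
  have hEpos : 0 < errG M (R T) T lam α := by
    unfold errG
    have := hR0 T
    positivity
  have hC0 : 0 ≤ C := by
    have h := (norm_nonneg _).trans h2
    exact nonneg_of_mul_nonneg_left h hEpos
  nlinarith [mul_le_mul_of_nonneg_left hE1 hC0, mul_le_mul_of_nonneg_left hE2 hC0]

end AH

/-- **BGSTB 2025, Lemma 5 (Heath-Brown), (iii)–(iv) — the AH-Pairs half, DISCHARGED in corrected
form.** The named claim `bgstb2025_lemma5_ah` (typed as printed: "assuming AH-Pairs", and (iv) with
the signed `|α| + 2L`) is NOT what §5 of the source proves: the proof uses Goldston–Montgomery's RH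
pair count (zeropairbound), and (iv) "follows immediately from (iii)" only with `|α| + 2|L|`. This is
the statement the printed proof establishes: under RH, for AH-Pairs data `(M, R)` and `0 < δ ≤ 1/2`,
(iii) as printed and (iv) with `|L|`, one constant `C` for all large `T`, all `0 < λ ≤ 1/2`, all `α`.
[cite: BaluyotGoldstonSuriajayaTurnageButterbaugh2025, Lemma 5 (iii)–(iv)] -/
theorem bgstb2025_lemma5_ah_of_RH (hRH : RiemannHypothesis) :
    ∀ M : ℝ, 0 < M → ∀ R : ℝ → ℝ, AH.IsPairsRate M R → ∀ δ : ℝ, 0 < δ → δ ≤ 1 / 2 →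
      ∃ C : ℝ, ∀ᶠ T : ℝ in atTop, ∀ lam : ℝ, 0 < lam → lam ≤ 1 / 2 → ∀ α : ℝ,
        ‖(AH.heathBrownG lam α T : ℂ) -
            ∑' k : ℤ, Complex.exp (π * k * α * Complex.I) *
              ((Real.sinc (lam * π * k / 2) ^ 2 * AH.binDensity k T M δ : ℝ) : ℂ)‖ ≤
          C * AH.errG M (R T) T lam α ∧
        ∀ L : ℤ, |AH.heathBrownG lam (α + 2 * L) T - AH.heathBrownG lam α T| ≤
          C * AH.errG M (R T) T lam (|α| + 2 * |(L : ℝ)|) := by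
  intro M hM R hR δ hδ hδ2
  obtain ⟨C₁, h₁⟩ := AH.heathBrownG_approx hRH hM hR hδ hδ2
  obtain ⟨C₂, h₂⟩ := AH.heathBrownG_add_two_mul_sub_le hRH hM hR hδ hδ2
  have hR0 : ∀ T, 0 < R T := hR.1
  refine ⟨max C₁ C₂, ?_⟩
  filter_upwards [h₁, h₂, eventually_gt_atTop (1 : ℝ)] with T hT₁ hT₂ hT1
  intro lam hlam hlam2 α
  have hE : ∀ β, 0 ≤ AH.errG M (R T) T lam β := by
    intro β; unfold AH.errG
    have := hR0 T
    have := Real.log_pos hT1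
    positivity
  refine ⟨(hT₁ lam hlam hlam2 α).trans (mul_le_mul_of_nonneg_right (le_max_left _ _) (hE _)),
    fun L ↦ (hT₂ lam hlam hlam2 α L).trans (mul_le_mul_of_nonneg_right (le_max_right _ _) (hE _))⟩

end Literature.NumberTheory.LFunctions

end
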